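import Literature.MathematicalPhysics.QuantumLattice.KomaTasakiGriffithsTheorem
import HarnessLib

/-!
# Koma–Tasaki 1993, Theorem 2.1 — PROOF (discharge of the named fact `kt93_theorem_2_1`)

T. Koma, H. Tasaki, *Symmetry breaking in Heisenberg antiferromagnets*, Commun. Math. Phys. **158**
(1993) 191–214 (`KomaTasaki1993`, held as `paper:doi-10-1007-bf02097237`, read at pp. 198–206 =
§3 "Construction of Commuting Operators", §4 "Probability Distribution of the Approximate
Magnetization in Zero-Field", §5 "Proof of the Main Theorem 2.1").  Sibling proof file of
`KomaTasakiGriffithsTheorem.lean` (statements; seat `hubbard-cq-lit-1`, cell `pub/hubbard-cq`): no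
definition and no statement is introduced here; this file proves
`theorem kt93_theorem_2_1_holds : kt93_theorem_2_1` — at every temperature the spontaneous
(staggered) magnetisation dominates the long-range order, for order operators that do NOT commute with
the Hamiltonian (the Griffiths–Dyson–Lieb–Simon theorem without `[H_Λ, O_Λ] = 0`).

## The printed proof (KT93 §§3–5) and its rendering

Fix `β` and one finite system (`Z2System`: `H = Σ h_x`, `O = Σ o_x`, ii) `‖h_x‖ ≤ h̄`, `‖o_x‖ ≤ ō`,
iii) `[h_x, o_y] = 0` unless `y ∈ S(x)`, `|S(x)| ≤ r`, a unitary `U` with `UHU⋆ = H`, `UOU⋆ = -O`).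
All quantities in Theorem 2.1 (traces against `e^{-βH}`, partition functions, operator norms) are
unitarily invariant, so the whole argument is run in an eigenbasis of `H_Λ` ("eigenbasis frame":
`V⋆ H V = diag(E)`, `O ↦ V⋆ O V`; `Z2System.moment_le_finiteVolume_aux`), where KT's spectral
projections `P(J)` (3.2) are diagonal `0/1` matrices.

* **§3, Lemma 3.1 (choice of the thresholds).**  KT cover the spectrum by windows `J_ℓ` of width
  `h̄√N/2`, subdivide each into `K` sub-windows of width `2D` and pick in each window the sub-window
  of least Boltzmann weight, so that the total weight within `D` of the chosen thresholds `{E_ℓ}`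
  is `≤ 1/K` ((3.5)–(3.8), "assume the converse … contradiction").  Here the same pigeonhole is run
  with ONE uniform shift `s` for all windows (the `K` shifted grids `(2s+1)D + ℓℤ` have disjoint
  `D`-neighbourhoods, so one of them carries weight `≤ Z/K`): `exists_threshold_shift`.  The blocks
  are then `I = [τ + bℓ, τ + (b+1)ℓ)`, labelled by `b = ⌊(E - τ)/ℓ⌋ ∈ ℤ`, of width `ℓ` (KT: `≤ h̄√N`),
  and a "good" eigenvalue (one in KT's `Ĩ_ℓ`, (3.26)) is `≥ D` away from every other block
  (`le_abs_sub_of_floor_ne`).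
* **§3, (3.10)–(3.15), Proposition 3.2.**  `H̃ = Σ_ℓ E_ℓ P(I_ℓ)` = `diagonal (τ + bℓ)` and
  `Õ = Σ_ℓ P(I_ℓ) O P(I_ℓ)` = the block truncation of `O`; `[H̃, Õ] = 0` (3.12)
  (`blockDiag_mul_blockTrunc_comm`), `H̃ ≤ H ≤ H̃ + ℓ` (3.13)–(3.14) (`blockBase_le_and_lt`), and
  inside a block `Õ` acts as the compression `P O P` (3.15)/(3.29) (`blockTrunc_pow_mul_blockProj`);
  `‖Õ‖ ≤ ‖O‖` (`norm_blockTrunc_le`).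
* **§3, Lemma 3.3 (gap bound).**  For an eigenvector `Φ_n` and a spectral window `J` at distance
  `≥ D` from `E_n`, `‖P(J) A Φ_n‖² ≤ 2‖A‖‖[H,A]‖/D` ((3.17)–(3.25): `P(J_±)(H - E_n) ≷ ±D` and
  `(H - E_n)AΦ_n = [H,A]Φ_n`).  Here in the sharper form `‖P(J)AΦ_n‖ ≤ ‖[H,A]Φ_n‖/D` obtained from
  the same identity by one Cauchy–Schwarz step (`sum_norm_sq_offBlock_le`: in the frame,
  `([H,A]e_i)_j = (E_j - E_i)A_{ji}`), together with KT's commutator count (3.23)–(3.24)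
  `‖[H, O^j]‖ ≤ j‖O‖^{j-1}‖[H,O]‖`, `‖[H_Λ,O_Λ]‖ ≤ 2rh̄ōN` (`norm_comm_pow_le`,
  `Z2System.norm_comm_hamiltonian_order_le`).
* **§3, proof of (3.16).**  KT split `⟨Õ^{2k}⟩ - ⟨O^{2k}⟩` into the `P(Ĩ_ℓ)` part, expanded into
  `2^{2k-1} - 1` words each containing a `P(Ī_ℓ)` and bounded by Lemma 3.3 ((3.29)–(3.31)), and the
  boundary part `P(I_ℓ∖Ĩ_ℓ)` of small weight ((3.27)–(3.28)).  Here the difference at a good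
  eigenvalue is TELESCOPED, `O^{2k} - Y^{2k} = Σ_j O^j(O - Y)Y^{2k-1-j}` with `Y = POP` and
  `(O - Y)P = P(Ī)OP`, each of the `2k` terms being bounded by Lemma 3.3 twice
  (`norm_pow_sub_blockTrunc_pow_apply_le`: `|(O^{2k} - Õ^{2k})_{ii}| ≤ 8k³κ²A^{2k}/D²`), and the bad
  eigenvalues contribute `≤ 2A^{2k} · (weight ≤ Z/K)` (`norm_trace_weight_mul_pow_sub_le`) — the same
  mechanism with fewer words (constants differ from the printed `2rk4^k ō^{2k} N^{-1/4}`; only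
  `→ 0` is used).
* **§4, Proposition 4.1, and §5.**  KT bound `Prob(|M| ≥ Nm)` for the joint eigenvalues `M` of
  `(H̃, Õ)` under the true Boltzmann weight by `2 e^{-βBNm} e^{-βN(f_Λ(B) - f_Λ(0))} e^{βh̄√N}`
  ((4.9)–(4.20): `Tr[P e^{-βH_Λ(B)}] ≤ Z_Λ(B)`, Jensen (4.14) in the joint eigenbasis, (3.15),
  Lemma 4.2 `‖H - H̃‖ ≤ h̄√N`, symmetry (2.5)), and then (5.1)–(5.3)
  `⟨Õ^{2k}⟩ ≤ (Nm)^{2k} + (ōN)^{2k} Prob(|M| ≥ Nm)`.  Here the same chain is written as OPERATOR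
  inequalities, which avoids constructing the joint eigenbasis: Markov in functional calculus
  `Õ^{2k} ≤ a^{2k} + ‖Õ‖^{2k}e^{-βBa}(e^{βBÕ} + e^{-βBÕ})` (`posSemidef_markov`), `e^{-βH} ≤ e^{-βH̃}`
  (3.13), `e^{-βH̃}e^{±βBÕ} = e^{-β(H̃ ∓ BÕ)}` (3.12), `Z(H̃ ∓ BÕ) ≤ e^{βℓ}Z(H ∓ BÕ)` (Lemma 4.2) and
  `Z(H ∓ BÕ) ≤ Z(H ∓ BO)` by the tree's Peierls–Bogoliubov inequality with `⟨O - Õ⟩_{H∓BÕ} = 0`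
  (block-diagonal against off-block; `partitionFn_blockTrunc_field_le`), `Z(-B) = Z(B)` by `U`
  (`Z2System.partitionFn_fieldHamiltonian_neg`).  Result (`re_trace_weight_pow_le_diag`,
  `Z2System.moment_le_finiteVolume`), the explicit-constant form of (5.3):
  `N^{-2k}⟨O^{2k}⟩_Λ(0) ≤ m^{2k} + 32k³(2rh̄)²ō^{2k}K²/ℓ² + 2ō^{2k}/K + 2ō^{2k}e^{βℓ}e^{-βN[Bm + f_Λ(B) - f_Λ(0)]}`
  for every `β > 0`, `B ≥ 0`, real `m`, `ℓ > 0`, `K ≥ 1`.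
* **§5, limits, with §4 (4.5)–(4.7), (4.21)–(4.24).**  `c_Λ = (f_Λ(0) - f_Λ(B))/B ∈ [0, m_Λ(B)]`
  ((4.6) = the tree's `Z2System.freeEnergy_zero_le`, and `f_Λ(B) ≤ f_Λ(0)` from `⟨O⟩_Λ(0) = 0`);
  hypothesis i) at the two fields `0`, `B` gives `c_Λ → c`; choosing `m = c + ε/4`, constants `K`, `ℓ`
  from `ε`, and `N → ∞` yields (2.13′) (`kt93_theorem_2_1_holds`).  KT take `ℓ = h̄√N`,
  `D = h̄N^{1/4}` and let `m ↓ m*` afterwards; for the typed `ε`–`j₀` statement fixed `K, ℓ` suffice.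

Tree/Mathlib used: `Matrix.gibbsWeight/partitionFn/gibbsState` (`FinDimSpectrum`), the
Peierls–Bogoliubov inequality `log_partitionFn_sub_le_log_partitionFn_add`, monotonicity
`log_partitionFn_le_of_posSemidef`, scalar shifts `log_partitionFn_add_smul_one`, the eigenbasis form
of `e^{-βH}` (`Matrix.IsHermitian.gibbsWeight_eq`), `norm_star_dotProduct_mulVec_le`, Mathlib's
`Matrix.exp_conj/exp_diagonal/exp_add_of_commute`, the `ℓ²` operator norm API and
`spectrum.norm_le_norm_of_mem`.  No new definitions, no named facts.
-/

noncomputable section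

open scoped Matrix.Norms.L2Operator ComplexOrder MatrixOrder Topology
open Matrix Filter Finset

namespace Literature.MathematicalPhysics.QuantumLattice.KomaTasaki

section Generic

variable {n : Type*} [Fintype n] [DecidableEq n]

/-- `Re Tr(C X) ≥ 0` for `C, X ⪰ 0`. [folklore] -/
private theorem re_trace_mul_nonneg_of_posSemidef {C X : Matrix n n ℂ} (hC : C.PosSemidef)
    (hX : X.PosSemidef) : 0 ≤ (C * X).trace.re := by
  obtain ⟨B, hB⟩ := CStarAlgebra.nonneg_iff_eq_star_mul_self.mp hC.nonneg
  rw [hB, star_eq_conjTranspose, Matrix.mul_assoc, trace_mul_comm]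
  exact (Complex.nonneg_iff.mp (hX.mul_mul_conjTranspose_same B).trace_nonneg).1

/-- Trace monotonicity: `Re Tr(C X) ≤ Re Tr(C Y)` for `C ⪰ 0` and `Y - X ⪰ 0`. [folklore] -/
private theorem re_trace_mul_le_of_posSemidef {C X Y : Matrix n n ℂ} (hC : C.PosSemidef)
    (hXY : (Y - X).PosSemidef) : (C * X).trace.re ≤ (C * Y).trace.re := by
  have h := re_trace_mul_nonneg_of_posSemidef hC hXY
  rw [Matrix.mul_sub, trace_sub, Complex.sub_re] at h
  linarith

/-- Trace monotonicity, right form: `Re Tr(X C) ≤ Re Tr(Y C)` for `C ⪰ 0` and `Y - X ⪰ 0`.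
[folklore] -/
private theorem re_trace_mul_le_of_posSemidef' {C X Y : Matrix n n ℂ} (hC : C.PosSemidef)
    (hXY : (Y - X).PosSemidef) : (X * C).trace.re ≤ (Y * C).trace.re := by
  rw [trace_mul_comm X, trace_mul_comm Y]
  exact re_trace_mul_le_of_posSemidef hC hXY

/-- A diagonal entry is bounded by the operator norm: `‖X i i‖ ≤ ‖X‖`. [folklore] -/
private theorem norm_apply_self_le_norm (X : Matrix n n ℂ) (i : n) : ‖X i i‖ ≤ ‖X‖ := by
  have h := norm_star_dotProduct_mulVec_le X (Pi.single i (1 : ℂ))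
  have hs : star (Pi.single i (1 : ℂ) : n → ℂ) = (Pi.single i (1 : ℂ) : n → ℂ) := by
    ext j
    by_cases hj : j = i
    · subst hj; simp
    · simp [hj]
  rw [hs, mulVec_single_one, single_dotProduct, single_dotProduct, one_mul, one_mul] at h
  simpa using h

/-- Column bound: `Σ_j ‖M j i‖² ≤ ‖M‖²` (`Σ_j |M_{ji}|² = (Mᴴ M)_{ii} ≤ ‖Mᴴ M‖ = ‖M‖²`). [folklore] -/
private theorem sum_norm_sq_apply_le (M : Matrix n n ℂ) (i : n) : ∑ j, ‖M j i‖ ^ 2 ≤ ‖M‖ ^ 2 := by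
  have h1 : (Mᴴ * M) i i = ((∑ j, ‖M j i‖ ^ 2 : ℝ) : ℂ) := by
    rw [Matrix.mul_apply, Complex.ofReal_sum]
    refine Finset.sum_congr rfl fun j _ => ?_
    rw [conjTranspose_apply, Complex.star_def, Complex.conj_mul', Complex.ofReal_pow]
  have h2 := norm_apply_self_le_norm (Mᴴ * M) i
  rw [h1, Complex.norm_real, Real.norm_of_nonneg (Finset.sum_nonneg fun j _ => sq_nonneg _),
    l2_opNorm_conjTranspose_mul_self, ← sq] at h2
  exact h2

omit [DecidableEq n] in
/-- `[H, AB] = [H, A] B + A [H, B]`. [folklore] -/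
private theorem comm_mul_eq (H A B : Matrix n n ℂ) :
    H * (A * B) - A * B * H = (H * A - A * H) * B + A * (H * B - B * H) := by
  simp only [Matrix.sub_mul, Matrix.mul_sub, Matrix.mul_assoc]
  abel

/-- `‖[H, AB]‖ ≤ ‖[H, A]‖ ‖B‖ + ‖A‖ ‖[H, B]‖`. [folklore] -/
private theorem norm_comm_mul_le (H A B : Matrix n n ℂ) :
    ‖H * (A * B) - A * B * H‖ ≤ ‖H * A - A * H‖ * ‖B‖ + ‖A‖ * ‖H * B - B * H‖ := by
  rw [comm_mul_eq]
  exact (norm_add_le _ _).trans (add_le_add (l2_opNorm_mul _ _) (l2_opNorm_mul _ _))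

/-- `‖1‖ ≤ 1` for the `ℓ²` operator norm. [folklore] -/
private theorem l2_opNorm_one_le : ‖(1 : Matrix n n ℂ)‖ ≤ 1 := by
  rw [← l2_opNorm_toEuclideanCLM, map_one, ContinuousLinearMap.one_def]
  exact ContinuousLinearMap.norm_id_le

/-- `‖X ^ j‖ ≤ A ^ j` if `‖X‖ ≤ A`. [folklore] -/
private theorem norm_pow_le_pow_of_le {X : Matrix n n ℂ} {A : ℝ} (hX : ‖X‖ ≤ A) (j : ℕ) :
    ‖X ^ j‖ ≤ A ^ j := by
  have hA : 0 ≤ A := (norm_nonneg _).trans hX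
  induction j with
  | zero => simpa using l2_opNorm_one_le
  | succ j ih =>
    rw [pow_succ, pow_succ]
    exact (l2_opNorm_mul _ _).trans (mul_le_mul ih hX (norm_nonneg _) (pow_nonneg hA _))

/-- Commutator with a power: `‖[H, X^j]‖ ≤ j κ A^j` when `‖X‖ ≤ A` and `‖[H, X]‖ ≤ κ A`
(KT93 (3.23)–(3.24): "`[H_Λ, A]` is a sum of `m` terms each with one `[H_Λ, O_Λ]`").
[cite: KomaTasaki1993, proof of Lemma 3.3, (3.22)–(3.24)] -/
theorem norm_comm_pow_le {H X : Matrix n n ℂ} {A κ : ℝ} (hκ : 0 ≤ κ) (hX : ‖X‖ ≤ A)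
    (hc : ‖H * X - X * H‖ ≤ κ * A) (j : ℕ) : ‖H * X ^ j - X ^ j * H‖ ≤ j * κ * A ^ j := by
  have hA : 0 ≤ A := (norm_nonneg _).trans hX
  induction j with
  | zero => simp
  | succ j ih =>
    calc ‖H * X ^ (j + 1) - X ^ (j + 1) * H‖ = ‖H * (X ^ j * X) - X ^ j * X * H‖ := by
          rw [pow_succ]
      _ ≤ ‖H * X ^ j - X ^ j * H‖ * ‖X‖ + ‖X ^ j‖ * ‖H * X - X * H‖ := norm_comm_mul_le _ _ _
      _ ≤ (j * κ * A ^ j) * A + A ^ j * (κ * A) :=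
          add_le_add (mul_le_mul ih hX (norm_nonneg _)
              (mul_nonneg (mul_nonneg (Nat.cast_nonneg _) hκ) (pow_nonneg hA _)))
            (mul_le_mul (norm_pow_le_pow_of_le hX j) hc (norm_nonneg _) (pow_nonneg hA _))
      _ = (j + 1 : ℕ) * κ * A ^ (j + 1) := by push_cast; ring

/-- Noncommutative telescoping: `X^m - Y^m = Σ_{j<m} X^j (X - Y) Y^{m-1-j}`. [folklore] -/
private theorem pow_sub_pow_eq_sum (X Y : Matrix n n ℂ) (m : ℕ) :
    X ^ m - Y ^ m = ∑ j ∈ Finset.range m, X ^ j * (X - Y) * Y ^ (m - 1 - j) := by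
  induction m with
  | zero => simp
  | succ m ih =>
    have hrec : X ^ (m + 1) - Y ^ (m + 1) = X * (X ^ m - Y ^ m) + (X - Y) * Y ^ m := by
      rw [pow_succ', pow_succ', Matrix.mul_sub, Matrix.sub_mul]
      abel
    rw [hrec, ih, Finset.mul_sum, Finset.sum_range_succ' (fun j => X ^ j * (X - Y) * Y ^ (m + 1 - 1 - j))]
    congr 1
    · refine Finset.sum_congr rfl fun j hj => ?_
      have hj' : j < m := Finset.mem_range.mp hj
      rw [pow_succ', show m + 1 - 1 - (j + 1) = m - 1 - j by omega]
      simp only [Matrix.mul_assoc]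
    · simp

end Generic

/-! ### KT93 Lemma 3.1 (choice of the energy thresholds): a uniform-shift pigeonhole -/

section Thresholds

variable {n : Type*} [Fintype n]

/-- If `x` is within `D` of the shifted grid `(2s+1)D + ℤℓ` (`ℓ = 2KD`, `0 ≤ s < K` an integer),
then the sub-window index `⌊fract(x/ℓ)·K⌋` of `x` equals `s`. [cite: KomaTasaki1993, proof of Lemma 3.1] -/
theorem floor_fract_mul_eq_of_near {ℓ D : ℝ} {K : ℕ} (hD : 0 < D) (hℓ : ℓ = 2 * K * D)
    {s : ℤ} (hs0 : 0 ≤ s) (hsK : s < K) {x : ℝ} {z : ℤ}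
    (hx : |x - ((2 * s + 1) * D + z * ℓ)| < D) : ⌊Int.fract (x / ℓ) * K⌋ = s := by
  have hK : (0 : ℝ) < K := by
    have : (0 : ℝ) ≤ s := by exact_mod_cast hs0
    have : (s : ℝ) < K := by exact_mod_cast hsK
    linarith
  have hℓ0 : 0 < ℓ := by rw [hℓ]; positivity
  rw [abs_lt] at hx
  obtain ⟨h1, h2⟩ := hx
  -- `2 s D < x - z ℓ < (2 s + 2) D`
  have hfr : Int.fract (x / ℓ) = x / ℓ - z := by
    rw [Int.fract_eq_iff]
    refine ⟨?_, ?_, ⟨z, by ring⟩⟩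
    · rw [sub_nonneg, le_div_iff₀ hℓ0]
      have : (0 : ℝ) ≤ 2 * s * D := by
        have : (0 : ℝ) ≤ s := by exact_mod_cast hs0
        positivity
      nlinarith
    · rw [sub_lt_iff_lt_add, div_lt_iff₀ hℓ0]
      have : (s : ℝ) + 1 ≤ K := by exact_mod_cast hsK
      have : (2 * s + 2) * D ≤ ℓ := by rw [hℓ]; nlinarith
      nlinarith
  rw [hfr, Int.floor_eq_iff]
  have hK0 : (K : ℝ) ≠ 0 := hK.ne'
  have hkey : (x / ℓ - z) * K = (x - z * ℓ) / (2 * D) := by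
    rw [hℓ]
    field_simp
  rw [hkey, le_div_iff₀ (by positivity), div_lt_iff₀ (by positivity)]
  constructor
  · linarith
  · linarith

/-- **KT93 Lemma 3.1 (uniform-shift form).** Non-negative weights `w` on finitely many energies
`E i`; block width `ℓ = 2KD`, `K ≥ 1`.  Among the `K` shifted threshold grids
`τ_s + ℤℓ`, `τ_s = (2s+1)D`, one has total weight at distance `< D` from it at most `(Σ w)/K`
("assume the converse … `Σ_ℓ min_k ⟨P(ΔJ_ℓ^{(k)})⟩ > 4N^{-1/4}` … which is a contradiction").
[cite: KomaTasaki1993, Lemma 3.1 (3.5)–(3.8)] -/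
theorem exists_threshold_shift (E : n → ℝ) {w : n → ℝ} (hw : ∀ i, 0 ≤ w i) {ℓ D : ℝ} {K : ℕ}
    (hD : 0 < D) (hK : 1 ≤ K) (hℓ : ℓ = 2 * K * D) :
    ∃ τ : ℝ, ∀ S : Finset n, (∀ i ∈ S, ∃ z : ℤ, |E i - (τ + z * ℓ)| < D) →
      ∑ i ∈ S, w i ≤ (∑ i, w i) / K := by
  classical
  have hK0 : (0 : ℝ) < K := by exact_mod_cast hK
  set sub : n → ℤ := fun i => ⌊Int.fract (E i / ℓ) * K⌋ with hsub
  have hmaps : ∀ i ∈ (univ : Finset n), sub i ∈ Finset.Ico (0 : ℤ) K := by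
    intro i _
    rw [Finset.mem_Ico]
    constructor
    · exact Int.floor_nonneg.mpr (mul_nonneg (Int.fract_nonneg _) hK0.le)
    · rw [Int.floor_lt]
      push_cast
      calc Int.fract (E i / ℓ) * K < 1 * K :=
            mul_lt_mul_of_pos_right (Int.fract_lt_one _) hK0
        _ = K := one_mul _
  have hfib : ∑ s ∈ Finset.Ico (0 : ℤ) K, ∑ i ∈ univ.filter (fun i => sub i = s), w i = ∑ i, w i :=
    Finset.sum_fiberwise_of_maps_to hmaps w
  have hne : (Finset.Ico (0 : ℤ) K).Nonempty := ⟨0, by simp; omega⟩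
  have hconst : ∑ _s ∈ Finset.Ico (0 : ℤ) K, (∑ i, w i) / K = ∑ i, w i := by
    rw [Finset.sum_const, Int.card_Ico, nsmul_eq_mul]
    simp only [sub_zero, Int.toNat_natCast]
    field_simp
  obtain ⟨s, hs, hle⟩ := Finset.exists_le_of_sum_le hne (le_of_eq (hfib.trans hconst.symm))
  rw [Finset.mem_Ico] at hs
  refine ⟨(2 * s + 1) * D, fun S hS => le_trans ?_ hle⟩
  apply Finset.sum_le_sum_of_subset_of_nonneg
  · intro i hi
    rw [Finset.mem_filter]
    obtain ⟨z, hz⟩ := hS i hi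
    exact ⟨Finset.mem_univ _, floor_fract_mul_eq_of_near hD hℓ hs.1 hs.2 hz⟩
  · intro i _ _
    exact hw i

/-- Blocks `⌊(x - τ)/ℓ⌋`: the block base `τ + ⌊(x-τ)/ℓ⌋ ℓ` lies in `[x - ℓ, x]`.
[cite: KomaTasaki1993, (3.9)–(3.10), (3.13)–(3.14)] -/
theorem blockBase_le_and_lt {ℓ : ℝ} (hℓ : 0 < ℓ) (τ x : ℝ) :
    τ + ⌊(x - τ) / ℓ⌋ * ℓ ≤ x ∧ x < τ + ⌊(x - τ) / ℓ⌋ * ℓ + ℓ := by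
  have h1 := Int.floor_le ((x - τ) / ℓ)
  have h2 := Int.lt_floor_add_one ((x - τ) / ℓ)
  rw [le_div_iff₀ hℓ] at h1
  rw [div_lt_iff₀ hℓ] at h2
  constructor <;> nlinarith

/-- **Separation of a good energy from the other blocks**: if `x` keeps distance `≥ D` from every
threshold `τ + zℓ`, then every `y` in a different block `⌊(y-τ)/ℓ⌋ ≠ ⌊(x-τ)/ℓ⌋` satisfies
`|y - x| ≥ D` (KT93: "`E_n ∈ Ĩ_ℓ` … any `E ∈ Ī_ℓ` satisfies `|E - E_n| ≥ h̄N^{1/4}`").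
[cite: KomaTasaki1993, (3.26) and the use of Lemma 3.3 in (3.30)] -/
theorem le_abs_sub_of_floor_ne {ℓ D : ℝ} (hℓ : 0 < ℓ) {τ x y : ℝ}
    (hgood : ∀ z : ℤ, D ≤ |x - (τ + z * ℓ)|) (hne : ⌊(y - τ) / ℓ⌋ ≠ ⌊(x - τ) / ℓ⌋) :
    D ≤ |y - x| := by
  obtain ⟨hxl, hxu⟩ := blockBase_le_and_lt hℓ τ x
  obtain ⟨hyl, hyu⟩ := blockBase_le_and_lt hℓ τ y
  rcases lt_or_gt_of_ne hne with hlt | hgt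
  · -- block of `y` below block of `x`: threshold `θ = τ + ⌊(x-τ)/ℓ⌋ ℓ` has `y < θ ≤ x`
    have hz : (⌊(y - τ) / ℓ⌋ : ℝ) + 1 ≤ ⌊(x - τ) / ℓ⌋ := by exact_mod_cast hlt
    have hθ := hgood ⌊(x - τ) / ℓ⌋
    have hyθ : y < τ + ⌊(x - τ) / ℓ⌋ * ℓ := by nlinarith
    rw [abs_of_nonneg (by linarith)] at hθ
    rw [abs_sub_comm, abs_of_nonneg (by linarith)]
    linarith
  · have hz : (⌊(x - τ) / ℓ⌋ : ℝ) + 1 ≤ ⌊(y - τ) / ℓ⌋ := by exact_mod_cast hgt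
    have hθ := hgood ⌊(y - τ) / ℓ⌋
    have hxθ : x < τ + ⌊(y - τ) / ℓ⌋ * ℓ := by nlinarith
    rw [abs_of_nonpos (by linarith)] at hθ
    rw [abs_of_nonneg (by linarith)]
    linarith

end Thresholds

/-! ### KT93 §3: the commuting (coarse-grained) operators, in the eigenbasis frame of `H_Λ`

Frame: `H = diagonal E` (real energies `E i`), block labels `g : n → ℤ` (in the application
`g i = ⌊(E i - τ)/ℓ⌋`), block projections `P b = diagonal 1_{g = b}` (KT's `P(I_ℓ)`, (3.2), (3.9)),
the truncated order operator `X = Õ_Λ` with entries `O i j` for `g i = g j` and `0` otherwise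
(`= Σ_ℓ P(I_ℓ) O_Λ P(I_ℓ)`, (3.11)), and block Hamiltonian `diagonal (e ∘ g)` (`= Σ_ℓ E_ℓ P(I_ℓ)`,
(3.10)).  The objects are passed as variables with their defining equations (no definitions). -/

section Blocks

variable {n : Type*} [Fintype n] [DecidableEq n]
variable {g : n → ℤ} {O X : Matrix n n ℂ} {P : ℤ → Matrix n n ℂ}

/-- Entries of `P(I_ℓ) M`: rows outside the block are killed. [cite: KomaTasaki1993, (3.2)] -/
theorem blockProj_mul_apply (hP : ∀ b, P b = diagonal fun i => if g i = b then (1 : ℂ) else 0)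
    (b : ℤ) (M : Matrix n n ℂ) (i j : n) : (P b * M) i j = if g i = b then M i j else 0 := by
  rw [hP, diagonal_mul]; split_ifs <;> simp

/-- Entries of `M P(I_ℓ)`: columns outside the block are killed. [cite: KomaTasaki1993, (3.2)] -/
theorem mul_blockProj_apply (hP : ∀ b, P b = diagonal fun i => if g i = b then (1 : ℂ) else 0)
    (b : ℤ) (M : Matrix n n ℂ) (i j : n) : (M * P b) i j = if g j = b then M i j else 0 := by
  rw [hP, mul_diagonal]; split_ifs <;> simp

/-- `P(I_ℓ)² = P(I_ℓ)`. [cite: KomaTasaki1993, (3.2)] -/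
theorem blockProj_mul_self (hP : ∀ b, P b = diagonal fun i => if g i = b then (1 : ℂ) else 0)
    (b : ℤ) : P b * P b = P b := by
  ext i j
  rw [blockProj_mul_apply hP, hP, diagonal_apply]
  by_cases hi : g i = b <;> by_cases hij : i = j <;> simp [hi, hij]

omit [Fintype n] in
/-- `P(I_ℓ)` is Hermitian. [cite: KomaTasaki1993, (3.2)] -/
theorem isHermitian_blockProj (hP : ∀ b, P b = diagonal fun i => if g i = b then (1 : ℂ) else 0)
    (b : ℤ) : (P b).IsHermitian := by
  rw [hP]
  refine isHermitian_diagonal_of_self_adjoint _ (funext fun i => ?_)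
  by_cases h : g i = b <;> simp [h]

/-- `‖P(I_ℓ)‖ ≤ 1`. [cite: KomaTasaki1993, (3.2)] -/
theorem norm_blockProj_le (hP : ∀ b, P b = diagonal fun i => if g i = b then (1 : ℂ) else 0)
    (b : ℤ) : ‖P b‖ ≤ 1 := by
  rw [hP, l2_opNorm_diagonal]
  refine (pi_norm_le_iff_of_nonneg zero_le_one).mpr fun i => ?_
  by_cases h : g i = b <;> simp [h]

/-- `Õ P(I_ℓ) = P(I_ℓ) O P(I_ℓ)`. [cite: KomaTasaki1993, (3.11)] -/
theorem blockTrunc_mul_blockProj (hX : X = of fun i j => if g i = g j then O i j else 0)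
    (hP : ∀ b, P b = diagonal fun i => if g i = b then (1 : ℂ) else 0) (b : ℤ) :
    X * P b = P b * O * P b := by
  ext i j
  rw [mul_blockProj_apply hP, mul_blockProj_apply hP, blockProj_mul_apply hP, hX, of_apply]
  by_cases hj : g j = b
  · by_cases hi : g i = b
    · simp [hi, hj]
    · simp [hi, hj]
  · simp [hj]

/-- `P(I_ℓ) Õ = P(I_ℓ) O P(I_ℓ)`. [cite: KomaTasaki1993, (3.11)] -/
theorem blockProj_mul_blockTrunc (hX : X = of fun i j => if g i = g j then O i j else 0)
    (hP : ∀ b, P b = diagonal fun i => if g i = b then (1 : ℂ) else 0) (b : ℤ) :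
    P b * X = P b * O * P b := by
  ext i j
  rw [blockProj_mul_apply hP, mul_blockProj_apply hP, blockProj_mul_apply hP, hX, of_apply]
  by_cases hi : g i = b
  · by_cases hj : g j = b
    · simp [hi, hj]
    · have hbj : b ≠ g j := fun e => hj e.symm
      simp [hi, hj, hbj]
  · simp [hi]

/-- `Õ` commutes with the block projections. [cite: KomaTasaki1993, (3.11)–(3.12)] -/
theorem commute_blockProj_blockTrunc (hX : X = of fun i j => if g i = g j then O i j else 0)
    (hP : ∀ b, P b = diagonal fun i => if g i = b then (1 : ℂ) else 0) (b : ℤ) :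
    Commute (P b) X := by
  rw [Commute, SemiconjBy, blockProj_mul_blockTrunc hX hP, blockTrunc_mul_blockProj hX hP]

omit [Fintype n] [DecidableEq n] in
/-- `Õ` is Hermitian. [cite: KomaTasaki1993, (3.11)] -/
theorem isHermitian_blockTrunc (hX : X = of fun i j => if g i = g j then O i j else 0)
    (hO : O.IsHermitian) : X.IsHermitian := by
  rw [hX]
  refine Matrix.IsHermitian.ext fun i j => ?_
  simp only [of_apply]
  by_cases h : g i = g j
  · rw [if_pos h, if_pos h.symm]
    exact hO.apply i j
  · rw [if_neg h, if_neg (fun e => h e.symm), star_zero]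

/-- A diagonal matrix that is constant on blocks (`H̃_Λ = Σ_ℓ E_ℓ P(I_ℓ)`) commutes with `Õ`:
`[H̃_Λ, Õ_Λ] = 0`. [cite: KomaTasaki1993, Proposition 3.2 (3.12)] -/
theorem blockDiag_mul_blockTrunc_comm (hX : X = of fun i j => if g i = g j then O i j else 0)
    (e : ℤ → ℂ) : diagonal (fun i => e (g i)) * X = X * diagonal (fun i => e (g i)) := by
  ext i j
  rw [diagonal_mul, mul_diagonal, hX, of_apply]
  by_cases h : g i = g j
  · rw [if_pos h, h, mul_comm]
  · rw [if_neg h, mul_zero, zero_mul]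

/-- The diagonal Hamiltonian commutes with the block projections. [cite: KomaTasaki1993, (3.2)] -/
theorem diagonal_mul_blockProj_comm (hP : ∀ b, P b = diagonal fun i => if g i = b then (1 : ℂ) else 0)
    (d : n → ℂ) (b : ℤ) : diagonal d * P b = P b * diagonal d := by
  rw [hP, diagonal_mul_diagonal, diagonal_mul_diagonal]
  congr 1; funext i; ring

/-- `P Y = Y` for `Y = P O P`. [cite: KomaTasaki1993, (3.11)] -/
theorem blockProj_mul_comp (hP : ∀ b, P b = diagonal fun i => if g i = b then (1 : ℂ) else 0)
    (b : ℤ) : P b * (P b * O * P b) = P b * O * P b := by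
  rw [← Matrix.mul_assoc, ← Matrix.mul_assoc, blockProj_mul_self hP]

/-- `Y P = Y` for `Y = P O P`. [cite: KomaTasaki1993, (3.11)] -/
theorem comp_mul_blockProj (hP : ∀ b, P b = diagonal fun i => if g i = b then (1 : ℂ) else 0)
    (b : ℤ) : P b * O * P b * P b = P b * O * P b := by
  rw [Matrix.mul_assoc, blockProj_mul_self hP]

/-- `P (Y^m P) = Y^m P` (`m ≥ 0`) for `Y = P O P`. [cite: KomaTasaki1993, (3.11)] -/
theorem blockProj_mul_comp_pow_mul (hP : ∀ b, P b = diagonal fun i => if g i = b then (1 : ℂ) else 0)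
    (b : ℤ) (m : ℕ) : P b * ((P b * O * P b) ^ m * P b) = (P b * O * P b) ^ m * P b := by
  induction m with
  | zero => rw [pow_zero, Matrix.one_mul, blockProj_mul_self hP]
  | succ m ih =>
    rw [pow_succ', Matrix.mul_assoc, ← Matrix.mul_assoc (P b), blockProj_mul_comp hP]

/-- **`Õ^m P(I_ℓ) = (P(I_ℓ) O P(I_ℓ))^m P(I_ℓ)`**: inside one block the truncated order operator acts
as the compression `P O P` ((3.29): "`P(Ĩ_ℓ) Õ ⋯ Õ P(Ĩ_ℓ) = P(Ĩ_ℓ) O P(I_ℓ) O ⋯ P(I_ℓ) O P(Ĩ_ℓ)`").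
[cite: KomaTasaki1993, (3.29)] -/
theorem blockTrunc_pow_mul_blockProj (hX : X = of fun i j => if g i = g j then O i j else 0)
    (hP : ∀ b, P b = diagonal fun i => if g i = b then (1 : ℂ) else 0) (b : ℤ) (m : ℕ) :
    X ^ m * P b = (P b * O * P b) ^ m * P b := by
  induction m with
  | zero => simp
  | succ m ih =>
    calc X ^ (m + 1) * P b = X ^ m * (X * P b) := by rw [pow_succ, Matrix.mul_assoc]
      _ = X ^ m * P b * (O * P b) := by
          rw [blockTrunc_mul_blockProj hX hP]; simp only [Matrix.mul_assoc]
      _ = (P b * O * P b) ^ m * P b * (O * P b) := by rw [ih]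
      _ = (P b * O * P b) ^ m * (P b * O * P b) := by simp only [Matrix.mul_assoc]
      _ = (P b * O * P b) ^ (m + 1) * P b := by
          rw [pow_succ, Matrix.mul_assoc ((P b * O * P b) ^ m), comp_mul_blockProj hP]

/-- `‖P O P‖ ≤ ‖O‖`. [cite: KomaTasaki1993, Proposition 3.2] -/
theorem norm_comp_le (hP : ∀ b, P b = diagonal fun i => if g i = b then (1 : ℂ) else 0) (b : ℤ) :
    ‖P b * O * P b‖ ≤ ‖O‖ := by
  have h1 := norm_blockProj_le hP b
  calc ‖P b * O * P b‖ ≤ ‖P b * O‖ * ‖P b‖ := l2_opNorm_mul _ _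
    _ ≤ (‖P b‖ * ‖O‖) * ‖P b‖ := by gcongr; exact l2_opNorm_mul _ _
    _ ≤ (1 * ‖O‖) * 1 := by gcongr
    _ = ‖O‖ := by ring

/-- `‖[H, P O P]‖ ≤ ‖[H, O]‖` for diagonal `H` (the projections commute with `H`).
[cite: KomaTasaki1993, (3.23)] -/
theorem norm_comm_comp_le (hP : ∀ b, P b = diagonal fun i => if g i = b then (1 : ℂ) else 0)
    (d : n → ℂ) (b : ℤ) :
    ‖diagonal d * (P b * O * P b) - P b * O * P b * diagonal d‖ ≤ ‖diagonal d * O - O * diagonal d‖ := by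
  have hc := diagonal_mul_blockProj_comm hP d b
  have h : diagonal d * (P b * O * P b) - P b * O * P b * diagonal d =
      P b * (diagonal d * O - O * diagonal d) * P b := by
    rw [Matrix.mul_sub, Matrix.sub_mul]
    simp only [← Matrix.mul_assoc]
    rw [hc]
    simp only [Matrix.mul_assoc]
    rw [← hc]
  rw [h]
  have h1 := norm_blockProj_le hP b
  calc ‖P b * (diagonal d * O - O * diagonal d) * P b‖
      ≤ ‖P b * (diagonal d * O - O * diagonal d)‖ * ‖P b‖ := l2_opNorm_mul _ _
    _ ≤ (‖P b‖ * ‖diagonal d * O - O * diagonal d‖) * ‖P b‖ := by gcongr; exact l2_opNorm_mul _ _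
    _ ≤ (1 * ‖diagonal d * O - O * diagonal d‖) * 1 := by gcongr
    _ = ‖diagonal d * O - O * diagonal d‖ := by ring

omit [DecidableEq n] in
/-- The trace against a diagonal weight: `Tr(diag(w) M) = Σ_i w_i M_{ii}`. [folklore] -/
private theorem trace_diagonal_mul' [DecidableEq n] (w : n → ℂ) (M : Matrix n n ℂ) :
    (diagonal w * M).trace = ∑ i, w i * M i i := by
  simp [Matrix.trace, diagonal_mul]

/-- **`‖Õ‖ ≤ ‖O‖`**: the block truncation does not increase the operator norm
(`‖Õv‖² = Σ_ℓ ‖P_ℓ O P_ℓ v‖² ≤ ‖O‖² Σ_ℓ ‖P_ℓ v‖²`). [cite: KomaTasaki1993, Proposition 3.2, (3.28)] -/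
theorem norm_blockTrunc_le (hX : X = of fun i j => if g i = g j then O i j else 0) : ‖X‖ ≤ ‖O‖ := by
  classical
  -- block restriction of a vector
  have key : ∀ v : n → ℂ, ∑ j, ‖(X *ᵥ v) j‖ ^ 2 ≤ ‖O‖ ^ 2 * ∑ a, ‖v a‖ ^ 2 := by
    intro v
    set T : Finset ℤ := univ.image g with hT
    have hmaps : ∀ a ∈ (univ : Finset n), g a ∈ T := fun a _ => mem_image_of_mem g (mem_univ a)
    -- `(X v)_j = (O v^{(g j)})_j` with `v^{(b)} a = 1_{g a = b} v a`
    have hXv : ∀ j, (X *ᵥ v) j = (O *ᵥ fun a => if g a = g j then v a else 0) j := by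
      intro j
      simp only [mulVec, dotProduct, hX, of_apply]
      refine Finset.sum_congr rfl fun a _ => ?_
      by_cases h : g j = g a
      · rw [if_pos h, if_pos h.symm]
      · rw [if_neg h, if_neg (fun e => h e.symm), mul_zero, zero_mul]
    -- the block-`b` inequality from the operator norm
    have hblock : ∀ b : ℤ, ∑ j, ‖(O *ᵥ fun a => if g a = b then v a else 0) j‖ ^ 2 ≤
        ‖O‖ ^ 2 * ∑ a, ‖(fun a => if g a = b then v a else 0 : n → ℂ) a‖ ^ 2 := by
      intro b
      set u : n → ℂ := fun a => if g a = b then v a else 0 with hu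
      have h1 : ‖toEuclideanCLM (n := n) (𝕜 := ℂ) O (WithLp.toLp 2 u)‖ ≤ ‖O‖ * ‖WithLp.toLp 2 u‖ := by
        rw [← l2_opNorm_toEuclideanCLM]; exact ContinuousLinearMap.le_opNorm _ _
      rw [toEuclideanCLM_toLp] at h1
      have h2 : ‖(WithLp.toLp 2 (O *ᵥ u) : EuclideanSpace ℂ n)‖ ^ 2 = ∑ j, ‖(O *ᵥ u) j‖ ^ 2 := by
        rw [EuclideanSpace.norm_sq_eq]
      have h3 : ‖(WithLp.toLp 2 u : EuclideanSpace ℂ n)‖ ^ 2 = ∑ a, ‖u a‖ ^ 2 := by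
        rw [EuclideanSpace.norm_sq_eq]
      rw [← h2, ← h3, ← mul_pow]
      exact pow_le_pow_left₀ (norm_nonneg _) h1 2
    calc ∑ j, ‖(X *ᵥ v) j‖ ^ 2
        = ∑ b ∈ T, ∑ j ∈ univ.filter (fun j => g j = b), ‖(X *ᵥ v) j‖ ^ 2 :=
          (Finset.sum_fiberwise_of_maps_to hmaps _).symm
      _ = ∑ b ∈ T, ∑ j ∈ univ.filter (fun j => g j = b),
            ‖(O *ᵥ fun a => if g a = b then v a else 0) j‖ ^ 2 := by
          refine Finset.sum_congr rfl fun b _ => Finset.sum_congr rfl fun j hj => ?_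
          rw [hXv j, (Finset.mem_filter.mp hj).2]
      _ ≤ ∑ b ∈ T, ∑ j, ‖(O *ᵥ fun a => if g a = b then v a else 0) j‖ ^ 2 := by
          refine Finset.sum_le_sum fun b _ => ?_
          exact Finset.sum_le_sum_of_subset_of_nonneg (Finset.filter_subset _ _)
            (fun j _ _ => sq_nonneg _)
      _ ≤ ∑ b ∈ T, ‖O‖ ^ 2 * ∑ a, ‖(fun a => if g a = b then v a else 0 : n → ℂ) a‖ ^ 2 :=
          Finset.sum_le_sum fun b _ => hblock b
      _ = ‖O‖ ^ 2 * ∑ b ∈ T, ∑ a ∈ univ.filter (fun a => g a = b), ‖v a‖ ^ 2 := by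
          rw [Finset.mul_sum]
          refine Finset.sum_congr rfl fun b _ => ?_
          congr 1
          rw [Finset.sum_filter]
          refine Finset.sum_congr rfl fun a _ => ?_
          by_cases h : g a = b <;> simp [h]
      _ = ‖O‖ ^ 2 * ∑ a, ‖v a‖ ^ 2 := by rw [Finset.sum_fiberwise_of_maps_to hmaps]
  -- pass to the operator norm
  rw [← l2_opNorm_toEuclideanCLM]
  refine ContinuousLinearMap.opNorm_le_bound _ (norm_nonneg O) fun v => ?_
  have hv : v = WithLp.toLp 2 (WithLp.ofLp v) := (WithLp.toLp_ofLp 2 v).symm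
  rw [hv, toEuclideanCLM_toLp]
  have h2 : ‖(WithLp.toLp 2 (X *ᵥ WithLp.ofLp v) : EuclideanSpace ℂ n)‖ ^ 2 =
      ∑ j, ‖(X *ᵥ WithLp.ofLp v) j‖ ^ 2 := by
    rw [EuclideanSpace.norm_sq_eq]
  have h3 : ‖(WithLp.toLp 2 (WithLp.ofLp v) : EuclideanSpace ℂ n)‖ ^ 2 = ∑ a, ‖WithLp.ofLp v a‖ ^ 2 := by
    rw [EuclideanSpace.norm_sq_eq]
  have h4 := key (WithLp.ofLp v)
  rw [← h2, ← h3, ← mul_pow] at h4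
  exact (pow_le_pow_iff_left₀ (norm_nonneg _) (mul_nonneg (norm_nonneg _) (norm_nonneg _))
    two_ne_zero).mp h4

end Blocks

/-! ### KT93 Lemma 3.3 (the gap bound) and Proposition 3.2 (3.16) -/

section GapBound

variable {n : Type*} [Fintype n] [DecidableEq n]
variable {g : n → ℤ} {O X : Matrix n n ℂ} {P : ℤ → Matrix n n ℂ}

/-- Entries of a commutator with the diagonal Hamiltonian: `([H, A])_{ji} = (E_j - E_i) A_{ji}`.
[cite: KomaTasaki1993, proof of Lemma 3.3, (3.21)–(3.22)] -/
theorem diagonal_comm_apply (E : n → ℝ) (A : Matrix n n ℂ) (j i : n) :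
    (diagonal (fun i => (E i : ℂ)) * A - A * diagonal (fun i => (E i : ℂ))) j i =
      ((E j - E i : ℝ) : ℂ) * A j i := by
  rw [Matrix.sub_apply, diagonal_mul, mul_diagonal]
  push_cast
  ring

/-- **KT93 Lemma 3.3 (gap bound, sharpened by one Cauchy–Schwarz step).**  If the energy `E i`
keeps distance `≥ D` from all energies in the other blocks, then for every matrix `A` the part of
the column `A e_i` lying in the other blocks is small:
`Σ_{j ∉ block(i)} |A_{ji}|² ≤ ‖[H, A]‖² / D²` — because `([H,A] e_i)_j = (E_j - E_i) A_{ji}`.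
(Printed form: `(Φ_n, A⋆ P(J) A Φ_n) ≤ 2‖A‖ ‖[H_Λ,A]‖/D` for `J` at distance `≥ D` from `E_n`,
(3.21)–(3.25); the mechanism — `P(J_±)(H_Λ - E_n)P(J_±) ≷ ±D P(J_±)` and
`(H_Λ - E_n) A Φ_n = [H_Λ, A] Φ_n` — is the same.) [cite: KomaTasaki1993, Lemma 3.3 (3.17)–(3.25)] -/
theorem sum_norm_sq_offBlock_le {E : n → ℝ} {D : ℝ} (hD : 0 < D) {i : n}
    (hsep : ∀ j, g j ≠ g i → D ≤ |E j - E i|) (A : Matrix n n ℂ) :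
    ∑ j ∈ univ.filter (fun j => g j ≠ g i), ‖A j i‖ ^ 2 ≤
      ‖diagonal (fun i => (E i : ℂ)) * A - A * diagonal (fun i => (E i : ℂ))‖ ^ 2 / D ^ 2 := by
  rw [le_div_iff₀ (pow_pos hD 2), Finset.sum_mul]
  calc ∑ j ∈ univ.filter (fun j => g j ≠ g i), ‖A j i‖ ^ 2 * D ^ 2
      ≤ ∑ j ∈ univ.filter (fun j => g j ≠ g i),
          ‖(diagonal (fun i => (E i : ℂ)) * A - A * diagonal (fun i => (E i : ℂ))) j i‖ ^ 2 := by
        refine Finset.sum_le_sum fun j hj => ?_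
        have hgj := (Finset.mem_filter.mp hj).2
        rw [diagonal_comm_apply, norm_mul, mul_pow, Complex.norm_real, Real.norm_eq_abs, sq_abs,
          mul_comm]
        exact mul_le_mul_of_nonneg_right
          (by have h := hsep j hgj; nlinarith [abs_nonneg (E j - E i), sq_abs (E j - E i)])
          (sq_nonneg _)
    _ ≤ ∑ j, ‖(diagonal (fun i => (E i : ℂ)) * A - A * diagonal (fun i => (E i : ℂ))) j i‖ ^ 2 :=
        Finset.sum_le_sum_of_subset_of_nonneg (Finset.filter_subset _ _) (fun _ _ _ => sq_nonneg _)
    _ ≤ _ := sum_norm_sq_apply_le _ i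

/-- Square-root form of the gap bound. [cite: KomaTasaki1993, Lemma 3.3 (3.17)] -/
theorem sqrt_sum_norm_sq_offBlock_le {E : n → ℝ} {D : ℝ} (hD : 0 < D) {i : n}
    (hsep : ∀ j, g j ≠ g i → D ≤ |E j - E i|) (A : Matrix n n ℂ) :
    Real.sqrt (∑ j ∈ univ.filter (fun j => g j ≠ g i), ‖A j i‖ ^ 2) ≤
      ‖diagonal (fun i => (E i : ℂ)) * A - A * diagonal (fun i => (E i : ℂ))‖ / D := by
  have h := Real.sqrt_le_sqrt (sum_norm_sq_offBlock_le hD hsep A)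
  rwa [Real.sqrt_div' _ (sq_nonneg D), Real.sqrt_sq (norm_nonneg _), Real.sqrt_sq hD.le] at h

/-- The telescoping term inside one block: `O^j (O - Y) Y^m P = O^j (1 - P) (O (Y^m P))`, `Y = P O P`
(the factor `1 - P = P(Ī_ℓ)` is where Lemma 3.3 enters, cf. (3.29)–(3.30)).
[cite: KomaTasaki1993, (3.29)–(3.30)] -/
theorem telescope_term_eq (hP : ∀ b, P b = diagonal fun i => if g i = b then (1 : ℂ) else 0)
    (b : ℤ) (j m : ℕ) :
    O ^ j * (O - P b * O * P b) * (P b * O * P b) ^ m * P b =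
      O ^ j * (1 - P b) * (O * ((P b * O * P b) ^ m * P b)) := by
  have hcomp : (P b * O * P b) ^ m * P b = P b * ((P b * O * P b) ^ m * P b) :=
    (blockProj_mul_comp_pow_mul hP b m).symm
  have hOY : (O - P b * O * P b) * P b = (1 - P b) * (O * P b) := by
    rw [Matrix.sub_mul, comp_mul_blockProj hP, Matrix.sub_mul, Matrix.one_mul, ← Matrix.mul_assoc]
  calc O ^ j * (O - P b * O * P b) * (P b * O * P b) ^ m * P b
      = O ^ j * ((O - P b * O * P b) * ((P b * O * P b) ^ m * P b)) := by
        simp only [Matrix.mul_assoc]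
    _ = O ^ j * ((O - P b * O * P b) * (P b * ((P b * O * P b) ^ m * P b))) :=
        congrArg (fun Z => O ^ j * ((O - P b * O * P b) * Z)) hcomp
    _ = O ^ j * (((O - P b * O * P b) * P b) * ((P b * O * P b) ^ m * P b)) := by
        simp only [Matrix.mul_assoc]
    _ = O ^ j * (((1 - P b) * (O * P b)) * ((P b * O * P b) ^ m * P b)) := by rw [hOY]
    _ = O ^ j * ((1 - P b) * (O * (P b * ((P b * O * P b) ^ m * P b)))) := by
        simp only [Matrix.mul_assoc]
    _ = O ^ j * ((1 - P b) * (O * ((P b * O * P b) ^ m * P b))) := by rw [← hcomp]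
    _ = O ^ j * (1 - P b) * (O * ((P b * O * P b) ^ m * P b)) := by
        simp only [Matrix.mul_assoc]

/-- Diagonal entry of `M₁ (1 - P) M₂`: only the off-block indices contribute.
[cite: KomaTasaki1993, (3.29)] -/
theorem mul_one_sub_blockProj_mul_apply
    (hP : ∀ b, P b = diagonal fun i => if g i = b then (1 : ℂ) else 0) (b : ℤ)
    (M₁ M₂ : Matrix n n ℂ) (i : n) :
    (M₁ * (1 - P b) * M₂) i i = ∑ a ∈ univ.filter (fun a => ¬ g a = b), M₁ i a * M₂ a i := by
  rw [Matrix.mul_apply, Finset.sum_filter]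
  refine Finset.sum_congr rfl fun a _ => ?_
  rw [Matrix.mul_sub, Matrix.mul_one, Matrix.sub_apply, mul_blockProj_apply hP]
  by_cases h : g a = b <;> simp [h]

/-- **KT93 Proposition 3.2, estimate (3.16) at one good eigenvalue** (telescoped form).  In the
eigenbasis frame, if `E i` keeps distance `≥ D` from the energies of all other blocks, then
`|(O^{2k} - Õ^{2k})_{ii}| ≤ 8k³ κ² A^{2k} / D²`, where `‖O‖ ≤ A` and `‖[H, O]‖ ≤ κA`.  Printed route:
expand `P(Ĩ_ℓ)(O^{2k} - Õ^{2k})P(Ĩ_ℓ)` into `2^{2k-1} - 1` words each containing a `P(Ī_ℓ)` and bound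
each by Lemma 3.3 ((3.29)–(3.31), constant `(2^{2k-1}-1)·4rk(ōN)^{2k} N^{-1/4}`); here the
difference is telescoped, `O^{2k} - Y^{2k} = Σ_j O^j (O - Y) Y^{2k-1-j}` with `(O - Y)P = P(Ī)OP`,
and each of the `2k` terms is bounded by Lemma 3.3 twice (Cauchy–Schwarz) — same mechanism, fewer
words. [cite: KomaTasaki1993, Proposition 3.2 (3.16), proof (3.29)–(3.31)] -/
theorem norm_pow_sub_blockTrunc_pow_apply_le
    (hX : X = of fun i j => if g i = g j then O i j else 0)
    (hP : ∀ b, P b = diagonal fun i => if g i = b then (1 : ℂ) else 0)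
    (hO : O.IsHermitian) {E : n → ℝ} {D A κ : ℝ} (hD : 0 < D) (hκ : 0 ≤ κ) (hA : ‖O‖ ≤ A)
    (hc : ‖diagonal (fun i => (E i : ℂ)) * O - O * diagonal (fun i => (E i : ℂ))‖ ≤ κ * A)
    {i : n} (hsep : ∀ j, g j ≠ g i → D ≤ |E j - E i|) (k : ℕ) :
    ‖(O ^ (2 * k) - X ^ (2 * k)) i i‖ ≤ 8 * k ^ 3 * κ ^ 2 * A ^ (2 * k) / D ^ 2 := by
  have hA0 : 0 ≤ A := (norm_nonneg _).trans hA
  set b := g i with hb_def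
  set Hd : Matrix n n ℂ := diagonal (fun i => (E i : ℂ)) with hHd
  set Y : Matrix n n ℂ := P b * O * P b with hY
  have hgi : g i = b := rfl
  -- a-priori bounds for `Y`
  have hYA : ‖Y‖ ≤ A := (norm_comp_le hP b).trans hA
  have hYc : ‖Hd * Y - Y * Hd‖ ≤ κ * A := (norm_comm_comp_le hP _ b).trans hc
  -- Step 1: `(X^{2k})_{ii} = (Y^{2k})_{ii}` and reduction to `(O^{2k} - Y^{2k}) P`
  have h1 : (O ^ (2 * k) - X ^ (2 * k)) i i = ((O ^ (2 * k) - Y ^ (2 * k)) * P b) i i := by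
    have h := congrFun (congrFun (blockTrunc_pow_mul_blockProj hX hP b (2 * k)) i) i
    rw [mul_blockProj_apply hP, mul_blockProj_apply hP, if_pos hgi, if_pos hgi] at h
    rw [mul_blockProj_apply hP, if_pos hgi, Matrix.sub_apply, Matrix.sub_apply, h]
  -- Step 2: telescoping
  have h2 : (O ^ (2 * k) - Y ^ (2 * k)) * P b =
      ∑ j ∈ Finset.range (2 * k), O ^ j * (1 - P b) * (O * (Y ^ (2 * k - 1 - j) * P b)) := by
    rw [pow_sub_pow_eq_sum, Finset.sum_mul]
    exact Finset.sum_congr rfl fun j _ => telescope_term_eq hP b j _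
  -- Step 3: bound of one term
  have hterm : ∀ j ∈ Finset.range (2 * k),
      ‖(O ^ j * (1 - P b) * (O * (Y ^ (2 * k - 1 - j) * P b))) i i‖ ≤
        (2 * k) * (2 * k) * κ ^ 2 * A ^ (2 * k) / D ^ 2 := by
    intro j hj
    have hj2k : j < 2 * k := Finset.mem_range.mp hj
    set m := 2 * k - 1 - j with hm
    rw [mul_one_sub_blockProj_mul_apply hP]
    -- the second factor's entries: `(O (Y^m P))_{ai} = (O Y^m)_{ai}`
    have hM2 : ∀ a, (O * (Y ^ m * P b)) a i = (O * Y ^ m) a i := by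
      intro a
      rw [← Matrix.mul_assoc, mul_blockProj_apply hP, if_pos hgi]
    -- Hermitian symmetry of the first factor's entries
    have hM1 : ∀ a, ‖(O ^ j) i a‖ = ‖(O ^ j) a i‖ := by
      intro a
      rw [← (hO.pow j).apply i a, norm_star]
    calc ‖∑ a ∈ univ.filter (fun a => ¬ g a = b), (O ^ j) i a * (O * (Y ^ m * P b)) a i‖
        ≤ ∑ a ∈ univ.filter (fun a => ¬ g a = b), ‖(O ^ j) i a * (O * (Y ^ m * P b)) a i‖ :=
          norm_sum_le _ _
      _ = ∑ a ∈ univ.filter (fun a => ¬ g a = b), ‖(O ^ j) a i‖ * ‖(O * Y ^ m) a i‖ := by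
          refine Finset.sum_congr rfl fun a _ => ?_
          rw [norm_mul, hM1, hM2]
      _ ≤ Real.sqrt (∑ a ∈ univ.filter (fun a => ¬ g a = b), ‖(O ^ j) a i‖ ^ 2) *
            Real.sqrt (∑ a ∈ univ.filter (fun a => ¬ g a = b), ‖(O * Y ^ m) a i‖ ^ 2) :=
          Real.sum_mul_le_sqrt_mul_sqrt _ _ _
      _ ≤ (‖Hd * O ^ j - O ^ j * Hd‖ / D) * (‖Hd * (O * Y ^ m) - O * Y ^ m * Hd‖ / D) :=
          mul_le_mul (sqrt_sum_norm_sq_offBlock_le hD hsep _)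
            (sqrt_sum_norm_sq_offBlock_le hD hsep _) (Real.sqrt_nonneg _)
            (div_nonneg (norm_nonneg _) hD.le)
      _ ≤ (j * κ * A ^ j / D) * ((m + 1) * κ * A ^ (m + 1) / D) := by
          have e1 : ‖Hd * O ^ j - O ^ j * Hd‖ ≤ j * κ * A ^ j := norm_comm_pow_le hκ hA hc j
          have e2 : ‖Hd * (O * Y ^ m) - O * Y ^ m * Hd‖ ≤ (m + 1) * κ * A ^ (m + 1) := by
            calc ‖Hd * (O * Y ^ m) - O * Y ^ m * Hd‖
                ≤ ‖Hd * O - O * Hd‖ * ‖Y ^ m‖ + ‖O‖ * ‖Hd * Y ^ m - Y ^ m * Hd‖ :=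
                  norm_comm_mul_le _ _ _
              _ ≤ (κ * A) * A ^ m + A * (m * κ * A ^ m) :=
                  add_le_add (mul_le_mul hc (norm_pow_le_pow_of_le hYA m) (norm_nonneg _)
                      (mul_nonneg hκ hA0))
                    (mul_le_mul hA (norm_comm_pow_le hκ hYA hYc m) (norm_nonneg _) hA0)
              _ = (m + 1) * κ * A ^ (m + 1) := by ring
          gcongr
      _ = j * (m + 1) * κ ^ 2 * A ^ (2 * k) / D ^ 2 := by
          have hjm : j + (m + 1) = 2 * k := by omega
          rw [← hjm, pow_add]
          ring
      _ ≤ (2 * k) * (2 * k) * κ ^ 2 * A ^ (2 * k) / D ^ 2 := by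
          have hj' : (j : ℝ) ≤ 2 * k := by exact_mod_cast hj2k.le
          have hm' : (m : ℝ) + 1 ≤ 2 * k := by
            have : m + 1 ≤ 2 * k := by omega
            exact_mod_cast this
          have hκA : 0 ≤ κ ^ 2 * A ^ (2 * k) / D ^ 2 := by positivity
          calc (j : ℝ) * (m + 1) * κ ^ 2 * A ^ (2 * k) / D ^ 2
              = (j * (m + 1)) * (κ ^ 2 * A ^ (2 * k) / D ^ 2) := by ring
            _ ≤ ((2 * k) * (2 * k)) * (κ ^ 2 * A ^ (2 * k) / D ^ 2) := by
                gcongr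
            _ = (2 * k) * (2 * k) * κ ^ 2 * A ^ (2 * k) / D ^ 2 := by ring
  -- Step 4: sum of the `2k` terms
  rw [h1, h2, Matrix.sum_apply]
  calc ‖∑ j ∈ Finset.range (2 * k), (O ^ j * (1 - P b) * (O * (Y ^ (2 * k - 1 - j) * P b))) i i‖
      ≤ ∑ j ∈ Finset.range (2 * k), ‖(O ^ j * (1 - P b) * (O * (Y ^ (2 * k - 1 - j) * P b))) i i‖ :=
        norm_sum_le _ _
    _ ≤ ∑ j ∈ Finset.range (2 * k), (2 * k) * (2 * k) * κ ^ 2 * A ^ (2 * k) / D ^ 2 :=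
        Finset.sum_le_sum hterm
    _ = 8 * k ^ 3 * κ ^ 2 * A ^ (2 * k) / D ^ 2 := by
        rw [Finset.sum_const, Finset.card_range, nsmul_eq_mul]
        push_cast
        ring

/-- **A-priori bound at every eigenvalue**: `|(O^{2k} - Õ^{2k})_{ii}| ≤ 2 A^{2k}` (used at the "bad"
eigenvalues near the thresholds, KT93 (3.28): "`≤ ‖(O_Λ)^{2k} - (Õ_Λ)^{2k}‖ Σ ⟨P(I_ℓ∖Ĩ_ℓ)⟩ ≤ 2(ōN)^{2k}
× 4N^{-1/4}`"). [cite: KomaTasaki1993, (3.28)] -/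
theorem norm_pow_sub_blockTrunc_pow_apply_le_two
    (hX : X = of fun i j => if g i = g j then O i j else 0)
    (hP : ∀ b, P b = diagonal fun i => if g i = b then (1 : ℂ) else 0)
    {A : ℝ} (hA : ‖O‖ ≤ A) (i : n) (k : ℕ) :
    ‖(O ^ (2 * k) - X ^ (2 * k)) i i‖ ≤ 2 * A ^ (2 * k) := by
  set b := g i with hb_def
  have hgi : g i = b := rfl
  have h := congrFun (congrFun (blockTrunc_pow_mul_blockProj hX hP b (2 * k)) i) i
  rw [mul_blockProj_apply hP, mul_blockProj_apply hP, if_pos hgi, if_pos hgi] at h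
  rw [Matrix.sub_apply, h]
  calc ‖(O ^ (2 * k)) i i - ((P b * O * P b) ^ (2 * k)) i i‖
      ≤ ‖(O ^ (2 * k)) i i‖ + ‖((P b * O * P b) ^ (2 * k)) i i‖ := norm_sub_le _ _
    _ ≤ ‖O ^ (2 * k)‖ + ‖(P b * O * P b) ^ (2 * k)‖ :=
        add_le_add (norm_apply_self_le_norm _ i) (norm_apply_self_le_norm _ i)
    _ ≤ A ^ (2 * k) + A ^ (2 * k) :=
        add_le_add (norm_pow_le_pow_of_le hA _) (norm_pow_le_pow_of_le ((norm_comp_le hP b).trans hA) _)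
    _ = 2 * A ^ (2 * k) := by ring

end GapBound

/-! ### KT93 Proposition 3.2 (3.16) against the Boltzmann weight -/

section CoarseGraining

variable {n : Type*} [Fintype n] [DecidableEq n]
variable {g : n → ℤ} {O X : Matrix n n ℂ} {P : ℤ → Matrix n n ℂ}

/-- The Gibbs weight of a real diagonal Hamiltonian is the diagonal of Boltzmann factors.
[folklore] -/
private theorem gibbsWeight_diagonal (β : ℝ) (E : n → ℝ) :
    gibbsWeight β (diagonal fun i => (E i : ℂ)) = diagonal fun i => (Real.exp (-(β * E i)) : ℂ) := by
  unfold gibbsWeight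
  have h : -(β : ℂ) • diagonal (fun i => (E i : ℂ)) = diagonal fun i => ((-(β * E i) : ℝ) : ℂ) := by
    rw [← diagonal_smul]
    congr 1
    funext i
    simp only [Pi.smul_apply, smul_eq_mul]
    push_cast
    ring
  rw [h, Matrix.exp_diagonal, Pi.exp_def]
  congr 1
  funext i
  rw [← Complex.exp_eq_exp_ℂ, Complex.ofReal_exp]

/-- The trace of the diagonal Gibbs weight: `Z = Σ_i e^{-βE_i}`. [folklore] -/
private theorem trace_gibbsWeight_diagonal (β : ℝ) (E : n → ℝ) :
    (gibbsWeight β (diagonal fun i => (E i : ℂ))).trace = ∑ i, (Real.exp (-(β * E i)) : ℂ) := by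
  rw [gibbsWeight_diagonal, trace_diagonal]

/-- **KT93 Proposition 3.2 (3.16), integrated against the Boltzmann weight** (eigenbasis frame):
`|Tr e^{-βH}(O^{2k} - Õ^{2k})| ≤ Z·(8k³κ²A^{2k}/D²) + (weight of the bad eigenvalues)·2A^{2k}`, where an
eigenvalue is "good" if it keeps distance `≥ D` from the energies of the other blocks ((3.27):
split into `P(Ĩ_ℓ)` and `P(I_ℓ∖Ĩ_ℓ)` parts, bounded by (3.31) and (3.28)).
[cite: KomaTasaki1993, Proposition 3.2 (3.16), proof (3.27)–(3.31)] -/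
theorem norm_trace_weight_mul_pow_sub_le
    (hX : X = of fun i j => if g i = g j then O i j else 0)
    (hP : ∀ b, P b = diagonal fun i => if g i = b then (1 : ℂ) else 0)
    (hO : O.IsHermitian) {E : n → ℝ} {D A κ : ℝ} (hD : 0 < D) (hκ : 0 ≤ κ) (hA : ‖O‖ ≤ A)
    (hc : ‖diagonal (fun i => (E i : ℂ)) * O - O * diagonal (fun i => (E i : ℂ))‖ ≤ κ * A)
    (good : n → Prop) [DecidablePred good]
    (hgood : ∀ i, good i → ∀ j, g j ≠ g i → D ≤ |E j - E i|)
    {w : n → ℝ} (hw : ∀ i, 0 ≤ w i) {η : ℝ} (hbad : ∑ i ∈ univ.filter (fun i => ¬ good i), w i ≤ η)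
    (k : ℕ) :
    ‖(diagonal (fun i => (w i : ℂ)) * (O ^ (2 * k) - X ^ (2 * k))).trace‖ ≤
      (∑ i, w i) * (8 * k ^ 3 * κ ^ 2 * A ^ (2 * k) / D ^ 2) + η * (2 * A ^ (2 * k)) := by
  have hA0 : 0 ≤ A := (norm_nonneg _).trans hA
  set M := O ^ (2 * k) - X ^ (2 * k) with hM
  set G : ℝ := 8 * k ^ 3 * κ ^ 2 * A ^ (2 * k) / D ^ 2 with hG
  have hG0 : 0 ≤ G := by positivity
  rw [trace_diagonal_mul']
  calc ‖∑ i, (w i : ℂ) * M i i‖ ≤ ∑ i, ‖(w i : ℂ) * M i i‖ := norm_sum_le _ _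
    _ = ∑ i, w i * ‖M i i‖ := by
        refine Finset.sum_congr rfl fun i _ => ?_
        rw [norm_mul, Complex.norm_real, Real.norm_of_nonneg (hw i)]
    _ = ∑ i ∈ univ.filter (fun i => good i), w i * ‖M i i‖ +
          ∑ i ∈ univ.filter (fun i => ¬ good i), w i * ‖M i i‖ :=
        (Finset.sum_filter_add_sum_filter_not _ _ _).symm
    _ ≤ ∑ i ∈ univ.filter (fun i => good i), w i * G +
          ∑ i ∈ univ.filter (fun i => ¬ good i), w i * (2 * A ^ (2 * k)) := by
        gcongr with i hi i hi
        · exact hw i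
        · exact norm_pow_sub_blockTrunc_pow_apply_le hX hP hO hD hκ hA hc
            (hgood i (Finset.mem_filter.mp hi).2) k
        · exact hw i
        · exact norm_pow_sub_blockTrunc_pow_apply_le_two hX hP hA i k
    _ ≤ (∑ i, w i) * G + η * (2 * A ^ (2 * k)) := by
        rw [← Finset.sum_mul, ← Finset.sum_mul]
        exact add_le_add
          (mul_le_mul_of_nonneg_right
            (Finset.sum_le_sum_of_subset_of_nonneg (Finset.filter_subset _ _) (fun i _ _ => hw i)) hG0)
          (mul_le_mul_of_nonneg_right hbad (by positivity))

end CoarseGraining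

/-! ### KT93 §4 (Proposition 4.1) and §5: the Markov / Griffiths step, as operator inequalities -/

section Markov

variable {n : Type*} [Fintype n] [DecidableEq n]

/-- Eigenvalues are bounded by the operator norm ("any eigenvalue of `H_Λ` is contained in the
interval `I = [-h̄N, h̄N]`"). [cite: KomaTasaki1993, (3.1)] -/
theorem abs_eigenvalues_le_norm [Nonempty n] {Y : Matrix n n ℂ} (hY : Y.IsHermitian) (j : n) :
    |hY.eigenvalues j| ≤ ‖Y‖ := by
  have h1 : ((hY.eigenvalues j : ℝ) : ℂ) ∈ spectrum ℂ Y := by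
    have := spectrum.algebraMap_mem ℂ (hY.eigenvalues_mem_spectrum_real j)
    rwa [Complex.coe_algebraMap] at this
  have h2 := spectrum.norm_le_norm_of_mem h1
  rwa [Complex.norm_real, Real.norm_eq_abs] at h2

/-- Powers of a unitarily diagonalised matrix. [folklore] -/
private theorem unitary_conj_diagonal_pow (U : unitary (Matrix n n ℂ)) (d : n → ℂ) (m : ℕ) :
    ((U : Matrix n n ℂ) * diagonal d * star (U : Matrix n n ℂ)) ^ m =
      (U : Matrix n n ℂ) * diagonal (fun i => d i ^ m) * star (U : Matrix n n ℂ) := by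
  induction m with
  | zero =>
    rw [pow_zero]
    simp only [pow_zero]
    rw [diagonal_one, Matrix.mul_one]
    exact (Unitary.coe_mul_star_self U).symm
  | succ m ih =>
    rw [pow_succ, ih]
    calc (U : Matrix n n ℂ) * diagonal (fun i => d i ^ m) * star (U : Matrix n n ℂ) *
          ((U : Matrix n n ℂ) * diagonal d * star (U : Matrix n n ℂ))
        = (U : Matrix n n ℂ) * diagonal (fun i => d i ^ m) * (star (U : Matrix n n ℂ) *
            (U : Matrix n n ℂ)) * diagonal d * star (U : Matrix n n ℂ) := by
          simp only [Matrix.mul_assoc]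
      _ = (U : Matrix n n ℂ) * (diagonal (fun i => d i ^ m) * diagonal d) * star (U : Matrix n n ℂ) := by
          rw [Unitary.coe_star_mul_self, Matrix.mul_one]; simp only [Matrix.mul_assoc]
      _ = (U : Matrix n n ℂ) * diagonal (fun i => d i ^ (m + 1)) * star (U : Matrix n n ℂ) := by
          simp only [diagonal_mul_diagonal, ← pow_succ]

omit [DecidableEq n] in
/-- Linear combinations of unitarily conjugated matrices. [folklore] -/
private theorem unitary_conj_combo (U : Matrix n n ℂ) (a c : ℂ) (D₀ D₁ D₂ D₃ : Matrix n n ℂ) :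
    a • (U * D₀ * star U) + c • (U * D₁ * star U + U * D₂ * star U) - U * D₃ * star U =
      U * (a • D₀ + c • (D₁ + D₂) - D₃) * star U := by
  simp only [Matrix.mul_add, Matrix.add_mul, Matrix.mul_sub, Matrix.sub_mul, Matrix.mul_smul,
    Matrix.smul_mul, smul_add]

/-- The scalar Markov/Chebyshev inequality behind KT93 (5.2): for `|x| ≤ R`, `t ≥ 0` and any real `a`,
`x^{2k} ≤ a^{2k} + R^{2k} e^{-ta}(e^{tx} + e^{-tx})` ("`⟨Õ^{2k}⟩ ≤ (ōN)^{2k} Prob(|M| ≥ Nm) + (Nm)^{2k}`"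
with `Prob(M ≥ Nm) ≤ e^{-βBNm} ⟨e^{βBM}⟩`). [cite: KomaTasaki1993, (5.1)–(5.2), (4.20)] -/
theorem pow_le_markov {x a t R : ℝ} (hx : |x| ≤ R) (ht : 0 ≤ t) (k : ℕ) :
    x ^ (2 * k) ≤ a ^ (2 * k) + R ^ (2 * k) * Real.exp (-(t * a)) * (Real.exp (t * x) + Real.exp (-(t * x))) := by
  have hR : 0 ≤ R := (abs_nonneg x).trans hx
  have hx2k : x ^ (2 * k) = |x| ^ (2 * k) := (Even.pow_abs ⟨k, two_mul k⟩ x).symm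
  have ha2k : 0 ≤ a ^ (2 * k) := Even.pow_nonneg ⟨k, two_mul k⟩ a
  have hpos : 0 ≤ R ^ (2 * k) * Real.exp (-(t * a)) * (Real.exp (t * x) + Real.exp (-(t * x))) := by
    positivity
  by_cases hxa : |x| ≤ a
  · have : |x| ^ (2 * k) ≤ a ^ (2 * k) := pow_le_pow_left₀ (abs_nonneg x) hxa _
    linarith
  · rw [not_le] at hxa
    have h1 : Real.exp (t * |x|) ≤ Real.exp (t * x) + Real.exp (-(t * x)) := by
      rcases le_or_gt 0 x with h | h
      · rw [abs_of_nonneg h]; linarith [Real.exp_pos (-(t * x))]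
      · rw [abs_of_neg h, mul_neg]; linarith [Real.exp_pos (t * x)]
    have h2 : 1 ≤ Real.exp (-(t * a)) * (Real.exp (t * x) + Real.exp (-(t * x))) := by
      calc (1 : ℝ) ≤ Real.exp (t * (|x| - a)) := Real.one_le_exp (by nlinarith)
        _ = Real.exp (-(t * a)) * Real.exp (t * |x|) := by rw [← Real.exp_add]; ring_nf
        _ ≤ Real.exp (-(t * a)) * (Real.exp (t * x) + Real.exp (-(t * x))) :=
            mul_le_mul_of_nonneg_left h1 (Real.exp_pos _).le
    have h3 : |x| ^ (2 * k) ≤ R ^ (2 * k) := pow_le_pow_left₀ (abs_nonneg x) hx _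
    calc x ^ (2 * k) = |x| ^ (2 * k) := hx2k
      _ ≤ R ^ (2 * k) * 1 := by linarith
      _ ≤ R ^ (2 * k) * (Real.exp (-(t * a)) * (Real.exp (t * x) + Real.exp (-(t * x)))) :=
          mul_le_mul_of_nonneg_left h2 (pow_nonneg hR _)
      _ ≤ _ := by rw [← mul_assoc]; linarith

/-- **The Markov step as an operator inequality** (KT93 (5.1)–(5.2) with (4.20), in functional
calculus): for Hermitian `Y`, `t ≥ 0` and real `a`,
`Y^{2k} ≤ a^{2k}·1 + ‖Y‖^{2k} e^{-ta} (e^{tY} + e^{-tY})`. [cite: KomaTasaki1993, (5.1)–(5.2), (4.20)] -/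
theorem posSemidef_markov [Nonempty n] {Y : Matrix n n ℂ} (hY : Y.IsHermitian) (a : ℝ) {t : ℝ}
    (ht : 0 ≤ t) (k : ℕ) :
    (((a ^ (2 * k) : ℝ) : ℂ) • (1 : Matrix n n ℂ) +
      ((‖Y‖ ^ (2 * k) * Real.exp (-(t * a)) : ℝ) : ℂ) • (gibbsWeight (-t) Y + gibbsWeight t Y) -
      Y ^ (2 * k)).PosSemidef := by
  set U := hY.eigenvectorUnitary with hU_def
  set μ := hY.eigenvalues with hμ
  set c : ℝ := ‖Y‖ ^ (2 * k) * Real.exp (-(t * a)) with hc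
  have hUU : (U : Matrix n n ℂ) * star (U : Matrix n n ℂ) = 1 := Unitary.coe_mul_star_self _
  -- the pieces in the eigenbasis of `Y`
  have h1 : (1 : Matrix n n ℂ) = (U : Matrix n n ℂ) * diagonal (fun _ => (1 : ℂ)) * star (U : Matrix n n ℂ) := by
    rw [diagonal_one, Matrix.mul_one, hUU]
  have hp : Y ^ (2 * k) = (U : Matrix n n ℂ) * diagonal (fun i => (μ i : ℂ) ^ (2 * k)) *
      star (U : Matrix n n ℂ) := by
    nth_rewrite 1 [hY.eq_conj_diagonal]
    exact unitary_conj_diagonal_pow _ _ _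
  have hg : ∀ s : ℝ, gibbsWeight s Y = (U : Matrix n n ℂ) *
      diagonal (fun i => (Real.exp (-(s * μ i)) : ℂ)) * star (U : Matrix n n ℂ) :=
    fun s => hY.gibbsWeight_eq s
  -- assemble `U diag(f) U⋆`
  have hM : ((a ^ (2 * k) : ℝ) : ℂ) • (1 : Matrix n n ℂ) +
      (c : ℂ) • (gibbsWeight (-t) Y + gibbsWeight t Y) - Y ^ (2 * k) =
      (U : Matrix n n ℂ) * diagonal (fun i => ((a ^ (2 * k) : ℝ) : ℂ) * 1 +
        (c : ℂ) * ((Real.exp (-(-t * μ i)) : ℂ) + (Real.exp (-(t * μ i)) : ℂ)) - (μ i : ℂ) ^ (2 * k)) *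
      star (U : Matrix n n ℂ) := by
    rw [hp, hg (-t), hg t]
    nth_rewrite 1 [h1]
    rw [unitary_conj_combo]
    congr 2
    ext i j
    simp only [Matrix.add_apply, Matrix.sub_apply, Matrix.smul_apply, diagonal_apply, smul_eq_mul]
    split_ifs <;> ring
  rw [hM, star_eq_conjTranspose]
  refine PosSemidef.mul_mul_conjTranspose_same (posSemidef_diagonal_iff.mpr fun i => ?_) _
  have hreal : ((a ^ (2 * k) : ℝ) : ℂ) * 1 +
      (c : ℂ) * ((Real.exp (-(-t * μ i)) : ℂ) + (Real.exp (-(t * μ i)) : ℂ)) - (μ i : ℂ) ^ (2 * k) =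
      ((a ^ (2 * k) + c * (Real.exp (t * μ i) + Real.exp (-(t * μ i))) - μ i ^ (2 * k) : ℝ) : ℂ) := by
    push_cast
    ring_nf
  rw [hreal, Complex.zero_le_real, sub_nonneg, hc, mul_assoc]
  have := pow_le_markov (abs_eigenvalues_le_norm hY i) ht k (a := a)
  linarith

/-- `e^{-βH} e^{βB X} = e^{-β(H - BX)}` for commuting `H`, `X`. [cite: KomaTasaki1993, (4.9)–(4.13)] -/
theorem gibbsWeight_mul_gibbsWeight_of_commute {H X : Matrix n n ℂ} (h : Commute H X) (β B : ℝ) :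
    gibbsWeight β H * gibbsWeight (-(β * B)) X = gibbsWeight β (H - (B : ℂ) • X) := by
  unfold gibbsWeight
  rw [← Matrix.exp_add_of_commute]
  · congr 1
    push_cast
    module
  · exact (h.smul_left _).smul_right _

/-- **Shifted monotonicity**: if `H₂ ≥ H₁ - ℓ` (i.e. `H₂ + ℓ - H₁ ⪰ 0`) then
`Z_β(H₂) ≤ e^{βℓ} Z_β(H₁)` (`β ≥ 0`).  Used with `H₂ = H̃_Λ(B)`, `H₁ = H_Λ - BÕ`,
`‖H̃_Λ - H_Λ‖ ≤ ℓ` (KT93 (3.13)–(3.14), Lemma 4.2 (4.17)–(4.18)). [cite: KomaTasaki1993, Lemma 4.2] -/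
theorem partitionFn_re_le_exp_mul [Nonempty n] {H₁ H₂ : Matrix n n ℂ} (hH₁ : H₁.IsHermitian)
    (hH₂ : H₂.IsHermitian) {β : ℝ} (hβ : 0 ≤ β) (ℓ : ℝ)
    (h : (H₂ + (ℓ : ℂ) • 1 - H₁).PosSemidef) :
    (partitionFn β H₂).re ≤ Real.exp (β * ℓ) * (partitionFn β H₁).re := by
  have hH₂' : (H₂ + (ℓ : ℂ) • (1 : Matrix n n ℂ)).IsHermitian :=
    hH₂.add (isHermitian_real_smul isHermitian_one ℓ)
  have h1 := log_partitionFn_le_of_posSemidef hH₁ hH₂' hβ h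
  rw [log_partitionFn_add_smul_one hH₂] at h1
  have hZ1 := partitionFn_re_pos hH₁ β
  have hZ2 := partitionFn_re_pos hH₂ β
  calc (partitionFn β H₂).re = Real.exp (Real.log (partitionFn β H₂).re) := (Real.exp_log hZ2).symm
    _ ≤ Real.exp (β * ℓ + Real.log (partitionFn β H₁).re) := Real.exp_le_exp.mpr (by linarith)
    _ = Real.exp (β * ℓ) * (partitionFn β H₁).re := by rw [Real.exp_add, Real.exp_log hZ1]

end Markov

/-! ### KT93 §4: comparison of partition functions (`H̃` vs `H`, `Õ` vs `O`) -/

section Partition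

variable {n : Type*} [Fintype n] [DecidableEq n]
variable {g : n → ℤ} {O X : Matrix n n ℂ} {P : ℤ → Matrix n n ℂ}

omit [Fintype n] in
/-- A real diagonal matrix is Hermitian. [folklore] -/
private theorem isHermitian_diagonal_ofReal (E : n → ℝ) : (diagonal fun i => (E i : ℂ)).IsHermitian :=
  isHermitian_diagonal_of_self_adjoint _ (funext fun i => by simp)

/-- The Gibbs weight of a block-diagonal Hamiltonian `H - BÕ` is block-diagonal (it commutes with
every `P(I_ℓ)`, as `e^{-βK}` is a limit of polynomials in `K`). [cite: KomaTasaki1993, (3.12), (4.9)–(4.13)] -/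
theorem gibbsWeight_apply_eq_zero_of_ne
    (hX : X = of fun i j => if g i = g j then O i j else 0)
    (hP : ∀ b, P b = diagonal fun i => if g i = b then (1 : ℂ) else 0)
    (E : n → ℝ) (β B : ℝ) {i j : n} (hij : g j ≠ g i) :
    gibbsWeight β (diagonal (fun i => (E i : ℂ)) - (B : ℂ) • X) i j = 0 := by
  set K := diagonal (fun i => (E i : ℂ)) - (B : ℂ) • X with hK
  have hcomm : Commute (P (g i)) K := by
    refine Commute.sub_right ?_ ((commute_blockProj_blockTrunc hX hP (g i)).smul_right _)
    exact (diagonal_mul_blockProj_comm hP _ (g i)).symm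
  have hG : Commute (P (g i)) (gibbsWeight β K) := by
    unfold gibbsWeight
    exact (hcomm.smul_right _).exp_right
  have h := congrFun (congrFun hG.eq i) j
  rw [blockProj_mul_apply hP, mul_blockProj_apply hP, if_pos rfl, if_neg hij] at h
  exact h

/-- The truncation error `O - Õ` has vanishing expectation in the Gibbs state of the truncated
field Hamiltonian `H - BÕ`: `Tr e^{-β(H - BÕ)} (Õ - O) = 0` (block-diagonal against off-block).
[cite: KomaTasaki1993, (3.11), (4.9)–(4.13)] -/
theorem trace_gibbsWeight_mul_blockTrunc_sub
    (hX : X = of fun i j => if g i = g j then O i j else 0)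
    (hP : ∀ b, P b = diagonal fun i => if g i = b then (1 : ℂ) else 0)
    (E : n → ℝ) (β B : ℝ) :
    (gibbsWeight β (diagonal (fun i => (E i : ℂ)) - (B : ℂ) • X) * (X - O)).trace = 0 := by
  rw [Matrix.trace]
  simp only [Matrix.diag_apply, Matrix.mul_apply]
  refine Finset.sum_eq_zero fun i _ => Finset.sum_eq_zero fun j _ => ?_
  by_cases h : g j = g i
  · have h0 : (X - O) j i = 0 := by
      rw [Matrix.sub_apply, hX, of_apply, if_pos h, sub_self]
    rw [h0, mul_zero]
  · rw [gibbsWeight_apply_eq_zero_of_ne hX hP E β B h, zero_mul]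

/-- **Peierls–Bogoliubov step `Z_β(H - BÕ) ≤ Z_β(H - BO)`**: the tree's Bogoliubov convexity
inequality `log Z(K) - β⟨W⟩_K ≤ log Z(K + W)` with `K = H - BÕ`, `W = B(Õ - O)`, `⟨W⟩_K = 0`.  This is
the step of KT93 §4 that passes from the commuting pair `(H̃, Õ)` back to the true `H_Λ(B) = H_Λ - BO_Λ`
((4.9)–(4.15): `Tr[P e^{-βH_Λ(B)}]/Tr[e^{-βH_Λ(B)}] ≤ 1` plus Jensen (4.14) in the joint eigenbasis of
`H̃_Λ, Õ_Λ`, and (3.15) `(Ψ, Õ_ΛΨ) = (Ψ, O_ΛΨ)`); here in trace form. [cite: KomaTasaki1993, (4.9)–(4.15)] -/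
theorem partitionFn_blockTrunc_field_le [Nonempty n]
    (hX : X = of fun i j => if g i = g j then O i j else 0)
    (hP : ∀ b, P b = diagonal fun i => if g i = b then (1 : ℂ) else 0)
    (hO : O.IsHermitian) (E : n → ℝ) (β B : ℝ) :
    (partitionFn β (diagonal (fun i => (E i : ℂ)) - (B : ℂ) • X)).re ≤
      (partitionFn β (diagonal (fun i => (E i : ℂ)) - (B : ℂ) • O)).re := by
  set Hd := diagonal (fun i => (E i : ℂ)) with hHd_def
  have hHd : Hd.IsHermitian := isHermitian_diagonal_ofReal E
  have hXh : X.IsHermitian := isHermitian_blockTrunc hX hO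
  have hK : (Hd - (B : ℂ) • X).IsHermitian := hHd.sub (isHermitian_real_smul hXh B)
  have hKO : (Hd - (B : ℂ) • O).IsHermitian := hHd.sub (isHermitian_real_smul hO B)
  have hW : ((B : ℂ) • X - (B : ℂ) • O).IsHermitian :=
    (isHermitian_real_smul hXh B).sub (isHermitian_real_smul hO B)
  have hPB := log_partitionFn_sub_le_log_partitionFn_add hK hW β
  have hzero : (gibbsState β (Hd - (B : ℂ) • X) ((B : ℂ) • X - (B : ℂ) • O)).re = 0 := by
    rw [gibbsState_apply, ← smul_sub, Matrix.mul_smul, trace_smul, hHd_def,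
      trace_gibbsWeight_mul_blockTrunc_sub hX hP E β B, smul_zero, mul_zero, Complex.zero_re]
  have hsum : Hd - (B : ℂ) • X + ((B : ℂ) • X - (B : ℂ) • O) = Hd - (B : ℂ) • O := by abel
  rw [hzero, mul_zero, sub_zero, hsum] at hPB
  exact (Real.log_le_log_iff (partitionFn_re_pos hK β) (partitionFn_re_pos hKO β)).mp hPB

/-- **KT93 §§4–5 in trace form** (eigenbasis frame; Proposition 4.1 with (5.1)–(5.2)).  With the
block Hamiltonian `H̃ = diagonal (e ∘ g)`, `H̃ ≤ H ≤ H̃ + ℓ` entrywise, `β > 0`, `B ≥ 0`, any real `a`: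
`Re Tr(e^{-βH} Õ^{2k}) ≤ a^{2k} Z_β(H) + ‖Õ‖^{2k} e^{-βBa} e^{βℓ} (Z_β(H - BO) + Z_β(H + BO))`.
Chain: Markov in functional calculus (`Õ^{2k} ≤ a^{2k} + ‖Õ‖^{2k}e^{-βBa}(e^{βBÕ} + e^{-βBÕ})`),
`e^{-βH} ≤ e^{-βH̃}` ((3.13)), `e^{-βH̃}e^{±βBÕ} = e^{-β(H̃ ∓ BÕ)}` ((3.12)),
`Z(H̃ ∓ BÕ) ≤ e^{βℓ} Z(H ∓ BÕ)` ((3.14), Lemma 4.2) and `Z(H ∓ BÕ) ≤ Z(H ∓ BO)` (Peierls–Bogoliubov).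
[cite: KomaTasaki1993, Proposition 4.1 (4.8), (4.19)–(4.20), (5.1)–(5.2)] -/
theorem re_trace_weight_blockTrunc_pow_le [Nonempty n]
    (hX : X = of fun i j => if g i = g j then O i j else 0)
    (hP : ∀ b, P b = diagonal fun i => if g i = b then (1 : ℂ) else 0)
    (hO : O.IsHermitian) {E : n → ℝ} {e : ℤ → ℝ} {ℓ : ℝ}
    (hlow : ∀ i, e (g i) ≤ E i) (hup : ∀ i, E i ≤ e (g i) + ℓ)
    {β : ℝ} (hβ : 0 < β) {B : ℝ} (hB : 0 ≤ B) (a : ℝ) (k : ℕ) :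
    (gibbsWeight β (diagonal fun i => (E i : ℂ)) * X ^ (2 * k)).trace.re ≤
      a ^ (2 * k) * (partitionFn β (diagonal fun i => (E i : ℂ))).re +
        ‖X‖ ^ (2 * k) * Real.exp (-(β * B * a)) * Real.exp (β * ℓ) *
          ((partitionFn β (diagonal (fun i => (E i : ℂ)) - (B : ℂ) • O)).re +
            (partitionFn β (diagonal (fun i => (E i : ℂ)) + (B : ℂ) • O)).re) := by
  set Hd : Matrix n n ℂ := diagonal (fun i => (E i : ℂ)) with hHd_def
  set Ht : Matrix n n ℂ := diagonal (fun i => ((e (g i) : ℝ) : ℂ)) with hHt_def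
  set c : ℝ := ‖X‖ ^ (2 * k) * Real.exp (-(β * B * a)) with hc_def
  have hc0 : 0 ≤ c := by positivity
  have hHd : Hd.IsHermitian := isHermitian_diagonal_ofReal E
  have hHt : Ht.IsHermitian := isHermitian_diagonal_ofReal _
  have hXh : X.IsHermitian := isHermitian_blockTrunc hX hO
  have hW : (gibbsWeight β Hd).PosSemidef := (posDef_gibbsWeight β hHd).posSemidef
  -- Step 1: Markov
  have hM := posSemidef_markov hXh a (mul_nonneg hβ.le hB) k
  have h1 := re_trace_mul_le_of_posSemidef hW hM
  have hexpand : (gibbsWeight β Hd * ((((a ^ (2 * k) : ℝ) : ℂ)) • (1 : Matrix n n ℂ) +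
      (c : ℂ) • (gibbsWeight (-(β * B)) X + gibbsWeight (β * B) X))).trace.re =
      a ^ (2 * k) * (partitionFn β Hd).re +
        c * ((gibbsWeight β Hd * gibbsWeight (-(β * B)) X).trace.re +
          (gibbsWeight β Hd * gibbsWeight (β * B) X).trace.re) := by
    rw [Matrix.mul_add, Matrix.mul_smul, Matrix.mul_one, Matrix.mul_smul, Matrix.mul_add, trace_add,
      trace_smul, trace_smul, trace_add, smul_eq_mul, smul_eq_mul, Complex.add_re,
      Complex.re_ofReal_mul, Complex.re_ofReal_mul, Complex.add_re, partitionFn]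
  rw [hexpand] at h1
  -- Step 2: `e^{-βH} ≤ e^{-βH̃}`
  have hWW : (gibbsWeight β Ht - gibbsWeight β Hd).PosSemidef := by
    rw [hHt_def, hHd_def, gibbsWeight_diagonal, gibbsWeight_diagonal, diagonal_sub]
    refine posSemidef_diagonal_iff.mpr fun i => ?_
    rw [← Complex.ofReal_sub, Complex.zero_le_real, sub_nonneg]
    exact Real.exp_le_exp.mpr (by nlinarith [hlow i, hβ.le])
  have h2 : ∀ s : ℝ, (gibbsWeight β Hd * gibbsWeight s X).trace.re ≤
      (gibbsWeight β Ht * gibbsWeight s X).trace.re := fun s =>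
    re_trace_mul_le_of_posSemidef' (posDef_gibbsWeight s hXh).posSemidef hWW
  -- Step 3: `e^{-βH̃} e^{±βBÕ} = e^{-β(H̃ ∓ BÕ)}`
  have hcomm : Commute Ht X := blockDiag_mul_blockTrunc_comm hX (fun b => ((e b : ℝ) : ℂ))
  have h3a : gibbsWeight β Ht * gibbsWeight (-(β * B)) X = gibbsWeight β (Ht - (B : ℂ) • X) :=
    gibbsWeight_mul_gibbsWeight_of_commute hcomm β B
  have h3b : gibbsWeight β Ht * gibbsWeight (β * B) X = gibbsWeight β (Ht + (B : ℂ) • X) := by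
    have h := gibbsWeight_mul_gibbsWeight_of_commute hcomm β (-B)
    rw [mul_neg, neg_neg] at h
    rw [h]
    congr 1
    push_cast
    rw [neg_smul, sub_neg_eq_add]
  -- Step 4: `Z(H̃ ∓ BX) ≤ e^{βℓ} Z(H ∓ BX)`
  have hdiag : ∀ Y : Matrix n n ℂ, (Ht + Y) + (ℓ : ℂ) • (1 : Matrix n n ℂ) - (Hd + Y) =
      diagonal fun i => ((e (g i) + ℓ - E i : ℝ) : ℂ) := by
    intro Y
    have : (Ht + Y) + (ℓ : ℂ) • (1 : Matrix n n ℂ) - (Hd + Y) = Ht + (ℓ : ℂ) • 1 - Hd := by abel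
    rw [this, hHt_def, hHd_def, smul_one_eq_diagonal, diagonal_add, diagonal_sub]
    congr 1
    funext i
    push_cast
    ring
  have hpsd : ∀ Y : Matrix n n ℂ, ((Ht + Y) + (ℓ : ℂ) • (1 : Matrix n n ℂ) - (Hd + Y)).PosSemidef := by
    intro Y
    rw [hdiag]
    refine posSemidef_diagonal_iff.mpr fun i => ?_
    rw [Complex.zero_le_real]
    linarith [hup i]
  have h4a : (partitionFn β (Ht - (B : ℂ) • X)).re ≤
      Real.exp (β * ℓ) * (partitionFn β (Hd - (B : ℂ) • X)).re := by
    have h := partitionFn_re_le_exp_mul (hHd.add (isHermitian_real_smul hXh B).neg)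
      (hHt.add (isHermitian_real_smul hXh B).neg) hβ.le ℓ (hpsd (-((B : ℂ) • X)))
    simpa only [← sub_eq_add_neg] using h
  have h4b : (partitionFn β (Ht + (B : ℂ) • X)).re ≤
      Real.exp (β * ℓ) * (partitionFn β (Hd + (B : ℂ) • X)).re :=
    partitionFn_re_le_exp_mul (hHd.add (isHermitian_real_smul hXh B))
      (hHt.add (isHermitian_real_smul hXh B)) hβ.le ℓ (hpsd _)
  -- Step 5: Peierls–Bogoliubov `Z(H ∓ BX) ≤ Z(H ∓ BO)`
  have h5a := partitionFn_blockTrunc_field_le hX hP hO E β B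
  have h5b : (partitionFn β (Hd + (B : ℂ) • X)).re ≤ (partitionFn β (Hd + (B : ℂ) • O)).re := by
    have h := partitionFn_blockTrunc_field_le hX hP hO E β (-B)
    simpa only [Complex.ofReal_neg, neg_smul, sub_neg_eq_add] using h
  -- assemble
  have hexp0 : 0 ≤ Real.exp (β * ℓ) := (Real.exp_pos _).le
  calc (gibbsWeight β Hd * X ^ (2 * k)).trace.re
      ≤ a ^ (2 * k) * (partitionFn β Hd).re +
          c * ((gibbsWeight β Hd * gibbsWeight (-(β * B)) X).trace.re +
            (gibbsWeight β Hd * gibbsWeight (β * B) X).trace.re) := h1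
    _ ≤ a ^ (2 * k) * (partitionFn β Hd).re +
          c * ((gibbsWeight β Ht * gibbsWeight (-(β * B)) X).trace.re +
            (gibbsWeight β Ht * gibbsWeight (β * B) X).trace.re) :=
        add_le_add le_rfl (mul_le_mul_of_nonneg_left (add_le_add (h2 _) (h2 _)) hc0)
    _ = a ^ (2 * k) * (partitionFn β Hd).re +
          c * ((partitionFn β (Ht - (B : ℂ) • X)).re + (partitionFn β (Ht + (B : ℂ) • X)).re) := by
        rw [h3a, h3b]; rfl
    _ ≤ a ^ (2 * k) * (partitionFn β Hd).re +
          c * (Real.exp (β * ℓ) * (partitionFn β (Hd - (B : ℂ) • O)).re +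
            Real.exp (β * ℓ) * (partitionFn β (Hd + (B : ℂ) • O)).re) := by
        gcongr
        · exact h4a.trans (mul_le_mul_of_nonneg_left h5a hexp0)
        · exact h4b.trans (mul_le_mul_of_nonneg_left h5b hexp0)
    _ = _ := by rw [hc_def]; ring

end Partition

/-! ### KT93 (5.3): the finite-volume inequality in the eigenbasis frame -/

section FiniteVolume

variable {n : Type*} [Fintype n] [DecidableEq n]

/-- **KT93 (5.3), eigenbasis frame, explicit constants.**  For a real diagonal `H = diag(E)`, a
Hermitian `O` with `‖O‖ ≤ A` and `‖[H, O]‖ ≤ κA`, `β > 0`, `B ≥ 0`, any real `a`, any block width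
`ℓ > 0` and sub-division number `K ≥ 1`:
`Re Tr(e^{-βH} O^{2k}) ≤ Z(0)·(a^{2k} + 8k³κ²A^{2k}(2K/ℓ)² + 2A^{2k}/K) + A^{2k}e^{-βBa}e^{βℓ}(Z(B) + Z(-B))`,
`Z(±B) = Z_β(H ∓ BO)`.  (Printed: `N^{-2k}⟨O^{2k}⟩_Λ(0) ≤ m^{2k} + 2ō^{2k}e^{-βNδ}e^{βh̄√N} + 2rk4^kō^{2k}N^{-1/4}`
with the choices `ℓ = h̄√N`, `D = h̄N^{1/4}`, `a = Nm`.) [cite: KomaTasaki1993, §5 (5.3); Proposition 3.2 (3.16); Proposition 4.1] -/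
theorem re_trace_weight_pow_le_diag [Nonempty n] {E : n → ℝ} {O : Matrix n n ℂ}
    (hO : O.IsHermitian) {A κ : ℝ} (hκ : 0 ≤ κ) (hA : ‖O‖ ≤ A)
    (hc : ‖diagonal (fun i => (E i : ℂ)) * O - O * diagonal (fun i => (E i : ℂ))‖ ≤ κ * A)
    {β : ℝ} (hβ : 0 < β) {B : ℝ} (hB : 0 ≤ B) (a : ℝ) (k : ℕ) {ℓ : ℝ} (hℓ : 0 < ℓ)
    {K : ℕ} (hK : 1 ≤ K) :
    (gibbsWeight β (diagonal fun i => (E i : ℂ)) * O ^ (2 * k)).trace.re ≤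
      (partitionFn β (diagonal fun i => (E i : ℂ))).re *
          (a ^ (2 * k) + 8 * k ^ 3 * κ ^ 2 * A ^ (2 * k) / (ℓ / (2 * K)) ^ 2 + 2 * A ^ (2 * k) / K) +
        A ^ (2 * k) * Real.exp (-(β * B * a)) * Real.exp (β * ℓ) *
          ((partitionFn β (diagonal (fun i => (E i : ℂ)) - (B : ℂ) • O)).re +
            (partitionFn β (diagonal (fun i => (E i : ℂ)) + (B : ℂ) • O)).re) := by
  classical
  have hA0 : 0 ≤ A := (norm_nonneg _).trans hA
  have hK0 : (0 : ℝ) < K := by exact_mod_cast hK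
  set D : ℝ := ℓ / (2 * K) with hD_def
  have hD : 0 < D := by positivity
  have hℓD : ℓ = 2 * K * D := by rw [hD_def]; field_simp
  set Hd : Matrix n n ℂ := diagonal (fun i => (E i : ℂ)) with hHd_def
  have hHd : Hd.IsHermitian := isHermitian_diagonal_ofReal E
  -- Boltzmann weights
  set w : n → ℝ := fun i => Real.exp (-(β * E i)) with hw_def
  have hw : ∀ i, 0 ≤ w i := fun i => (Real.exp_pos _).le
  have hWdiag : gibbsWeight β Hd = diagonal fun i => (w i : ℂ) := gibbsWeight_diagonal β E
  have hZ : (partitionFn β Hd).re = ∑ i, w i := by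
    rw [partitionFn, hHd_def, trace_gibbsWeight_diagonal, ← Complex.ofReal_sum, Complex.ofReal_re]
  -- Lemma 3.1: choose the threshold grid
  obtain ⟨τ, hτ⟩ := exists_threshold_shift E hw hD hK hℓD
  -- the block structure
  set g : n → ℤ := fun i => ⌊(E i - τ) / ℓ⌋ with hg_def
  set e : ℤ → ℝ := fun b => τ + b * ℓ with he_def
  set X : Matrix n n ℂ := of fun i j => if g i = g j then O i j else 0 with hX
  set P : ℤ → Matrix n n ℂ := fun b => diagonal fun i => if g i = b then (1 : ℂ) else 0 with hP_def
  have hP : ∀ b, P b = diagonal fun i => if g i = b then (1 : ℂ) else 0 := fun b => rfl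
  have hlow : ∀ i, e (g i) ≤ E i := fun i => (blockBase_le_and_lt hℓ τ (E i)).1
  have hup : ∀ i, E i ≤ e (g i) + ℓ := fun i => (blockBase_le_and_lt hℓ τ (E i)).2.le
  -- good eigenvalues and the bad weight
  set good : n → Prop := fun i => ∀ z : ℤ, D ≤ |E i - (τ + z * ℓ)| with hgood_def
  have hgood : ∀ i, good i → ∀ j, g j ≠ g i → D ≤ |E j - E i| :=
    fun i hi j hj => le_abs_sub_of_floor_ne hℓ hi hj
  have hbad : ∑ i ∈ univ.filter (fun i => ¬ good i), w i ≤ (∑ i, w i) / K := by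
    refine hτ _ fun i hi => ?_
    have h := (Finset.mem_filter.mp hi).2
    simp only [hgood_def, not_forall, not_le] at h
    exact h
  -- Proposition 3.2 (3.16) against the weight
  have h316 := norm_trace_weight_mul_pow_sub_le hX hP hO hD hκ hA hc good hgood hw hbad k
  rw [← hWdiag, ← hZ] at h316
  -- §§4–5
  have h45 := re_trace_weight_blockTrunc_pow_le hX hP hO (e := e) hlow hup hβ hB a k
  have hXA : ‖X‖ ^ (2 * k) ≤ A ^ (2 * k) :=
    pow_le_pow_left₀ (norm_nonneg _) ((norm_blockTrunc_le hX).trans hA) _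
  have hZpos : 0 < (partitionFn β Hd).re := partitionFn_re_pos hHd β
  have hZB : 0 ≤ (partitionFn β (Hd - (B : ℂ) • O)).re + (partitionFn β (Hd + (B : ℂ) • O)).re :=
    add_nonneg (partitionFn_re_pos (hHd.sub (isHermitian_real_smul hO B)) β).le
      (partitionFn_re_pos (hHd.add (isHermitian_real_smul hO B)) β).le
  -- split `O^{2k} = X^{2k} + (O^{2k} - X^{2k})`
  have hsplit : (gibbsWeight β Hd * O ^ (2 * k)).trace.re =
      (gibbsWeight β Hd * X ^ (2 * k)).trace.re +
        (gibbsWeight β Hd * (O ^ (2 * k) - X ^ (2 * k))).trace.re := by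
    rw [← Complex.add_re, ← trace_add, ← Matrix.mul_add, add_sub_cancel]
  rw [hsplit]
  have hre := (Complex.re_le_norm _).trans h316
  have hDK : 8 * (k : ℝ) ^ 3 * κ ^ 2 * A ^ (2 * k) / (ℓ / (2 * K)) ^ 2 =
      8 * k ^ 3 * κ ^ 2 * A ^ (2 * k) / D ^ 2 := by rw [hD_def]
  rw [hDK]
  calc (gibbsWeight β Hd * X ^ (2 * k)).trace.re +
        (gibbsWeight β Hd * (O ^ (2 * k) - X ^ (2 * k))).trace.re
      ≤ (a ^ (2 * k) * (partitionFn β Hd).re + ‖X‖ ^ (2 * k) * Real.exp (-(β * B * a)) *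
          Real.exp (β * ℓ) * ((partitionFn β (Hd - (B : ℂ) • O)).re +
            (partitionFn β (Hd + (B : ℂ) • O)).re)) +
        ((partitionFn β Hd).re * (8 * k ^ 3 * κ ^ 2 * A ^ (2 * k) / D ^ 2) +
          (partitionFn β Hd).re / K * (2 * A ^ (2 * k))) := add_le_add h45 hre
    _ ≤ (a ^ (2 * k) * (partitionFn β Hd).re + A ^ (2 * k) * Real.exp (-(β * B * a)) *
          Real.exp (β * ℓ) * ((partitionFn β (Hd - (B : ℂ) • O)).re +
            (partitionFn β (Hd + (B : ℂ) • O)).re)) +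
        ((partitionFn β Hd).re * (8 * k ^ 3 * κ ^ 2 * A ^ (2 * k) / D ^ 2) +
          (partitionFn β Hd).re / K * (2 * A ^ (2 * k))) := by
        gcongr
    _ = _ := by ring

end FiniteVolume

/-! ### Back to `H_Λ`: unitary change of frame, and the `ℤ₂` symmetry -/

section Frame

variable {n : Type*} [Fintype n] [DecidableEq n]

/-- `e^{-β UHU⋆} = U e^{-βH} U⋆` for `U` unitary (Mathlib `Matrix.exp_conj`). [folklore] -/
private theorem gibbsWeight_unitary_conj {U : Matrix n n ℂ} (hU : U ∈ unitary (Matrix n n ℂ)) (β : ℝ)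
    (H : Matrix n n ℂ) : gibbsWeight β (U * H * star U) = U * gibbsWeight β H * star U := by
  have hunit : IsUnit U := ⟨Unitary.toUnits ⟨U, hU⟩, rfl⟩
  have hinv : U⁻¹ = star U := by
    rw [Matrix.inv_eq_right_inv (Unitary.mul_star_self_of_mem hU)]
  unfold gibbsWeight
  rw [← hinv, show -(β : ℂ) • (U * H * U⁻¹) = U * (-(β : ℂ) • H) * U⁻¹ by
    rw [Matrix.mul_smul, Matrix.smul_mul], Matrix.exp_conj _ _ hunit]

/-- Powers of a conjugated matrix: `(W O V)^m = W O^m V` when `V W = 1 = W V`. [folklore] -/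
private theorem conj_pow_eq {W V : Matrix n n ℂ} (hVW : V * W = 1) (hWV : W * V = 1) (O : Matrix n n ℂ)
    (m : ℕ) : (W * O * V) ^ m = W * O ^ m * V := by
  induction m with
  | zero => rw [pow_zero, pow_zero, Matrix.mul_one, hWV]
  | succ m ih =>
    rw [pow_succ, ih, pow_succ]
    calc W * O ^ m * V * (W * O * V) = W * O ^ m * (V * W) * O * V := by
          simp only [Matrix.mul_assoc]
      _ = W * (O ^ m * O) * V := by rw [hVW, Matrix.mul_one]; simp only [Matrix.mul_assoc]

namespace Z2System

variable {N : ℕ} {hb ob : ℝ} {r : ℕ}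
variable (sys : Z2System N hb ob r n)

/-- **KT93 (3.24): `‖[H_Λ, O_Λ]‖ ≤ 2 r h̄ ō N`** from ii) and iii) (`[h_x, o_y] = 0` unless
`y ∈ S(x)`, `|S(x)| ≤ r`). [cite: KomaTasaki1993, (3.24)] -/
theorem norm_comm_hamiltonian_order_le :
    ‖sys.hamiltonian * sys.order - sys.order * sys.hamiltonian‖ ≤ 2 * r * hb * (N * ob) := by
  have hcomm : sys.hamiltonian * sys.order - sys.order * sys.hamiltonian =
      ∑ x, ∑ y ∈ sys.supp x, (sys.h x * sys.o y - sys.o y * sys.h x) := by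
    rw [hamiltonian, order, Finset.sum_mul_sum, Finset.sum_mul_sum, Finset.sum_comm (s := univ)
      (f := fun y x => sys.o y * sys.h x), ← Finset.sum_sub_distrib]
    refine Finset.sum_congr rfl fun x _ => ?_
    rw [← Finset.sum_sub_distrib]
    refine (Finset.sum_subset (Finset.subset_univ _) fun y _ hy => ?_).symm
    rw [sub_eq_zero]
    exact (sys.commute_h_o x y hy).eq
  rw [hcomm]
  calc ‖∑ x, ∑ y ∈ sys.supp x, (sys.h x * sys.o y - sys.o y * sys.h x)‖
      ≤ ∑ x, ‖∑ y ∈ sys.supp x, (sys.h x * sys.o y - sys.o y * sys.h x)‖ := norm_sum_le _ _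
    _ ≤ ∑ x, ∑ y ∈ sys.supp x, ‖sys.h x * sys.o y - sys.o y * sys.h x‖ :=
        Finset.sum_le_sum fun x _ => norm_sum_le _ _
    _ ≤ ∑ x, ∑ _y ∈ sys.supp x, 2 * hb * ob := by
        refine Finset.sum_le_sum fun x _ => Finset.sum_le_sum fun y _ => ?_
        have hhb : 0 ≤ hb := (norm_nonneg _).trans (sys.norm_h_le x)
        calc ‖sys.h x * sys.o y - sys.o y * sys.h x‖
            ≤ ‖sys.h x * sys.o y‖ + ‖sys.o y * sys.h x‖ := norm_sub_le _ _
          _ ≤ ‖sys.h x‖ * ‖sys.o y‖ + ‖sys.o y‖ * ‖sys.h x‖ :=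
              add_le_add (l2_opNorm_mul _ _) (l2_opNorm_mul _ _)
          _ ≤ hb * ob + ob * hb :=
              add_le_add (mul_le_mul (sys.norm_h_le x) (sys.norm_o_le y) (norm_nonneg _) hhb)
                (mul_le_mul (sys.norm_o_le y) (sys.norm_h_le x) (norm_nonneg _)
                  ((norm_nonneg _).trans (sys.norm_o_le y)))
          _ = 2 * hb * ob := by ring
    _ ≤ ∑ _x : Fin N, r * (2 * hb * ob) := by
        refine Finset.sum_le_sum fun x _ => ?_
        rw [Finset.sum_const, nsmul_eq_mul]
        have hhb : 0 ≤ hb := (norm_nonneg _).trans (sys.norm_h_le x)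
        have hob : 0 ≤ 2 * hb * ob := by
          rcases (sys.supp x).eq_empty_or_nonempty with h | ⟨y, hy⟩
          · have : 0 ≤ ob ∨ ob < 0 := le_or_gt 0 ob
            rcases this with h' | h'
            · positivity
            · -- no `y` needed: use any site's bound `‖o x‖ ≤ ob`
              exact absurd ((norm_nonneg _).trans (sys.norm_o_le x)) (not_le.mpr h')
          · have := (norm_nonneg _).trans (sys.norm_o_le y); positivity
        exact mul_le_mul_of_nonneg_right (by exact_mod_cast sys.card_supp_le x) hob
    _ = 2 * r * hb * (N * ob) := by
        rw [Finset.sum_const, Finset.card_univ, Fintype.card_fin, nsmul_eq_mul]; ring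

/-- The symmetry unitary `U_Λ` is unitary. [cite: KomaTasaki1993, (2.3), (2.5)] -/
theorem U_mem_unitary : sys.U ∈ unitary (Matrix n n ℂ) := by
  rw [Unitary.mem_iff, star_eq_conjTranspose]
  exact ⟨mul_eq_one_comm.mp sys.U_mul_conjTranspose, sys.U_mul_conjTranspose⟩

/-- `U_Λ H_Λ(-B) U_Λ* = H_Λ(B)`: the field flips sign under the symmetry. [cite: KomaTasaki1993, (2.3), (2.5), (4.20)] -/
theorem conj_fieldHamiltonian (B : ℝ) :
    sys.U * sys.fieldHamiltonian (-B) * star sys.U = sys.fieldHamiltonian B := by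
  rw [star_eq_conjTranspose, fieldHamiltonian, fieldHamiltonian, Matrix.mul_sub, Matrix.sub_mul,
    Matrix.mul_smul, Matrix.smul_mul, hamiltonian, order, sys.conj_hamiltonian, sys.conj_order]
  push_cast
  rw [neg_smul, smul_neg, sub_neg_eq_add, ← sub_eq_add_neg]

/-- **`Z_Λ(-B) = Z_Λ(B)`** ("where we used the symmetry (2.5)"). [cite: KomaTasaki1993, (4.20)] -/
theorem partitionFn_fieldHamiltonian_neg (β B : ℝ) :
    partitionFn β (sys.fieldHamiltonian (-B)) = partitionFn β (sys.fieldHamiltonian B) := by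
  rw [← sys.conj_fieldHamiltonian B, partitionFn_unitary_conj sys.U_mem_unitary]

/-- `⟨O_Λ⟩_Λ(0) = 0`: the zero-field Gibbs state is symmetric and `O_Λ` is odd.
[cite: KomaTasaki1993, (2.3), (2.5)] -/
theorem trace_gibbsWeight_mul_order (β : ℝ) :
    (gibbsWeight β sys.hamiltonian * sys.order).trace = 0 := by
  have hU := sys.U_mem_unitary
  have hUU : star sys.U * sys.U = 1 := Unitary.star_mul_self_of_mem hU
  have hH : sys.U * sys.hamiltonian * star sys.U = sys.hamiltonian := by
    rw [star_eq_conjTranspose, hamiltonian, sys.conj_hamiltonian]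
  have hO : star sys.U * sys.order * sys.U = -sys.order := by
    have h : sys.U * sys.order * star sys.U = -sys.order := by
      rw [star_eq_conjTranspose]; exact sys.conj_order
    have h2 : star sys.U * (sys.U * sys.order * star sys.U) * sys.U = sys.order := by
      calc star sys.U * (sys.U * sys.order * star sys.U) * sys.U
          = (star sys.U * sys.U) * sys.order * (star sys.U * sys.U) := by
            simp only [Matrix.mul_assoc]
        _ = sys.order := by rw [hUU, Matrix.one_mul, Matrix.mul_one]
    rw [h, Matrix.mul_neg, Matrix.neg_mul] at h2
    exact neg_eq_iff_eq_neg.mp h2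
  have hW : gibbsWeight β sys.hamiltonian = sys.U * gibbsWeight β sys.hamiltonian * star sys.U := by
    conv_lhs => rw [← hH]
    exact gibbsWeight_unitary_conj hU β _
  have h : (gibbsWeight β sys.hamiltonian * sys.order).trace =
      -(gibbsWeight β sys.hamiltonian * sys.order).trace := by
    conv_lhs => rw [hW]
    rw [show sys.U * gibbsWeight β sys.hamiltonian * star sys.U * sys.order =
        sys.U * (gibbsWeight β sys.hamiltonian * (star sys.U * sys.order)) by
          simp only [Matrix.mul_assoc],
      trace_mul_comm,
      show gibbsWeight β sys.hamiltonian * (star sys.U * sys.order) * sys.U =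
        gibbsWeight β sys.hamiltonian * (star sys.U * sys.order * sys.U) by
          simp only [Matrix.mul_assoc],
      hO, Matrix.mul_neg, trace_neg]
  have h2 : (2 : ℂ) * (gibbsWeight β sys.hamiltonian * sys.order).trace = 0 := by
    rw [two_mul]; nth_rewrite 2 [h]; exact add_neg_cancel _
  exact (mul_eq_zero.mp h2).resolve_left two_ne_zero

/-- **`f_Λ(B) ≤ f_Λ(0)`** (`β > 0`): Peierls–Bogoliubov at `B = 0` with `⟨O_Λ⟩_Λ(0) = 0` — the free
energy is even and concave in `B`, hence maximal at `B = 0`. [cite: KomaTasaki1993, §4 (4.5)–(4.7)] -/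
theorem freeEnergy_le_freeEnergy_zero [Nonempty n] {β : ℝ} (hβ : 0 < β) (B : ℝ) :
    sys.freeEnergy β B ≤ sys.freeEnergy β 0 := by
  have hPB := log_partitionFn_sub_le_log_partitionFn_add sys.isHermitian_hamiltonian
    (sys.isHermitian_smul_order B).neg β
  have hzero : (gibbsState β sys.hamiltonian (-((B : ℂ) • sys.order))).re = 0 := by
    rw [map_neg, map_smul, gibbsState_apply, sys.trace_gibbsWeight_mul_order, mul_zero, smul_zero,
      neg_zero, Complex.zero_re]
  rw [hzero, mul_zero, sub_zero, ← sub_eq_add_neg] at hPB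
  -- `log Z(0) ≤ log Z(B)`
  unfold freeEnergy
  rw [fieldHamiltonian_zero]
  rcases Nat.eq_zero_or_pos N with hN | hN
  · simp [hN]
  · have hβN : 0 < β * N := mul_pos hβ (Nat.cast_pos.mpr hN)
    have hi : 0 ≤ (β * N)⁻¹ := inv_nonneg.mpr hβN.le
    have := mul_le_mul_of_nonneg_left hPB hi
    change -(β * ↑N)⁻¹ * Real.log (partitionFn β (sys.hamiltonian - (B : ℂ) • sys.order)).re ≤
      -(β * ↑N)⁻¹ * Real.log (partitionFn β sys.hamiltonian).re
    linarith

/-- KT93 (5.3) for one finite system, in an arbitrary diagonalising frame `V⋆ H_Λ V = diag(E)`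
(auxiliary form of `moment_le_finiteVolume`). [cite: KomaTasaki1993, Theorem 2.1, proof §§3–5, (5.3)] -/
theorem moment_le_finiteVolume_aux [Nonempty n] (hN : 1 ≤ N) {β : ℝ} (hβ : 0 < β) {B : ℝ}
    (hB : 0 ≤ B) (m : ℝ) (k : ℕ) {ℓ : ℝ} (hℓ : 0 < ℓ) {K : ℕ} (hK : 1 ≤ K)
    {V : Matrix n n ℂ} (hVu : V ∈ unitary (Matrix n n ℂ)) {E : n → ℝ}
    (hHd_eq : star V * sys.hamiltonian * V = diagonal (fun i => (E i : ℂ))) :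
    sys.moment β k ≤ m ^ (2 * k) + 32 * k ^ 3 * (2 * r * hb) ^ 2 * ob ^ (2 * k) * K ^ 2 / ℓ ^ 2 +
      2 * ob ^ (2 * k) / K +
      2 * ob ^ (2 * k) * Real.exp (β * ℓ) *
        Real.exp (-(β * N * (B * m + sys.freeEnergy β B - sys.freeEnergy β 0))) := by
  have hH : sys.hamiltonian.IsHermitian := sys.isHermitian_hamiltonian
  have hO : sys.order.IsHermitian := sys.isHermitian_order
  have hVsu : star V ∈ unitary (Matrix n n ℂ) := Unitary.star_mem hVu
  have hVV : V * star V = 1 := Unitary.mul_star_self_of_mem hVu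
  have hsVV : star V * V = 1 := Unitary.star_mul_self_of_mem hVu
  have hOd : (star V * sys.order * V).IsHermitian := by
    have h := isHermitian_conjTranspose_mul_mul V hO
    rwa [← star_eq_conjTranspose] at h
  -- constants
  have hN0 : (0 : ℝ) < N := by exact_mod_cast hN
  have hhb : 0 ≤ hb := (norm_nonneg _).trans (sys.norm_h_le ⟨0, hN⟩)
  have hob : 0 ≤ ob := (norm_nonneg _).trans (sys.norm_o_le ⟨0, hN⟩)
  have hκ : 0 ≤ 2 * r * hb := by positivity
  have hA : ‖star V * sys.order * V‖ ≤ N * ob := by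
    rw [CStarRing.norm_mul_mem_unitary _ hVu, CStarRing.norm_mem_unitary_mul _ hVsu]
    exact sys.norm_order_le
  have hconj : ∀ Y : Matrix n n ℂ, diagonal (fun i => (E i : ℂ)) * (star V * Y * V) -
      star V * Y * V * diagonal (fun i => (E i : ℂ)) =
      star V * (sys.hamiltonian * Y - Y * sys.hamiltonian) * V := by
    intro Y
    rw [← hHd_eq, Matrix.mul_sub, Matrix.sub_mul]
    congr 1
    · calc star V * sys.hamiltonian * V * (star V * Y * V)
          = star V * sys.hamiltonian * (V * star V) * Y * V := by simp only [Matrix.mul_assoc]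
        _ = star V * (sys.hamiltonian * Y) * V := by
            rw [hVV, Matrix.mul_one]; simp only [Matrix.mul_assoc]
    · calc star V * Y * V * (star V * sys.hamiltonian * V)
          = star V * Y * (V * star V) * sys.hamiltonian * V := by simp only [Matrix.mul_assoc]
        _ = star V * (Y * sys.hamiltonian) * V := by
            rw [hVV, Matrix.mul_one]; simp only [Matrix.mul_assoc]
  have hc : ‖diagonal (fun i => (E i : ℂ)) * (star V * sys.order * V) -
      star V * sys.order * V * diagonal (fun i => (E i : ℂ))‖ ≤ (2 * r * hb) * (N * ob) := by
    rw [hconj, CStarRing.norm_mul_mem_unitary _ hVu, CStarRing.norm_mem_unitary_mul _ hVsu]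
    exact sys.norm_comm_hamiltonian_order_le
  -- the diagonal-frame inequality
  have key := re_trace_weight_pow_le_diag hOd hκ hA hc hβ hB (N * m) k hℓ hK
  -- transport back to `H_Λ`
  have hW : gibbsWeight β (diagonal fun i => (E i : ℂ)) = star V * gibbsWeight β sys.hamiltonian * V := by
    rw [← hHd_eq]
    have h := gibbsWeight_unitary_conj hVsu β sys.hamiltonian
    rwa [star_star] at h
  have hT : (gibbsWeight β (diagonal fun i => (E i : ℂ)) * (star V * sys.order * V) ^ (2 * k)).trace =
      (gibbsWeight β sys.hamiltonian * sys.order ^ (2 * k)).trace := by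
    rw [hW, conj_pow_eq hVV hsVV]
    calc (star V * gibbsWeight β sys.hamiltonian * V * (star V * sys.order ^ (2 * k) * V)).trace
        = (star V * (gibbsWeight β sys.hamiltonian * (V * star V) * sys.order ^ (2 * k)) * V).trace := by
          simp only [Matrix.mul_assoc]
      _ = (gibbsWeight β sys.hamiltonian * sys.order ^ (2 * k)).trace := by
          rw [hVV, Matrix.mul_one, trace_mul_cycle, hVV, Matrix.one_mul]
  have hZ0 : partitionFn β (diagonal fun i => (E i : ℂ)) = partitionFn β sys.hamiltonian := by
    rw [← hHd_eq]
    have h := partitionFn_unitary_conj hVsu β sys.hamiltonian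
    rwa [star_star] at h
  have hZfield : ∀ B' : ℝ, partitionFn β (diagonal (fun i => (E i : ℂ)) - (B' : ℂ) • (star V * sys.order * V)) =
      partitionFn β (sys.fieldHamiltonian B') := by
    intro B'
    have h1 : diagonal (fun i => (E i : ℂ)) - (B' : ℂ) • (star V * sys.order * V) =
        star V * (sys.fieldHamiltonian B') * V := by
      rw [fieldHamiltonian, ← hHd_eq, Matrix.mul_sub, Matrix.sub_mul, Matrix.mul_smul, Matrix.smul_mul]
    rw [h1]
    have h := partitionFn_unitary_conj hVsu β (sys.fieldHamiltonian B')
    rwa [star_star] at h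
  have hZplus : partitionFn β (diagonal (fun i => (E i : ℂ)) + (B : ℂ) • (star V * sys.order * V)) =
      partitionFn β (sys.fieldHamiltonian B) := by
    have h := hZfield (-B)
    rw [Complex.ofReal_neg, neg_smul, sub_neg_eq_add] at h
    rw [h, sys.partitionFn_fieldHamiltonian_neg]
  rw [hT, hZ0, hZfield B, hZplus] at key
  -- positivity of the partition functions, free energies
  have hZ0pos : 0 < (partitionFn β sys.hamiltonian).re := partitionFn_re_pos hH β
  have hF : ∀ B' : ℝ, (partitionFn β (sys.fieldHamiltonian B')).re =
      Real.exp (-(β * N * sys.freeEnergy β B')) := by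
    intro B'
    have hpos : 0 < (partitionFn β (sys.fieldHamiltonian B')).re :=
      partitionFn_re_pos (sys.isHermitian_fieldHamiltonian B') β
    have hβN : β * N ≠ 0 := (mul_pos hβ hN0).ne'
    rw [freeEnergy, show -(β * ↑N * (-(β * ↑N)⁻¹ * Real.log (partitionFn β (sys.fieldHamiltonian B')).re)) =
      Real.log (partitionFn β (sys.fieldHamiltonian B')).re by field_simp, Real.exp_log hpos]
  have hF0 : (partitionFn β sys.hamiltonian).re = Real.exp (-(β * N * sys.freeEnergy β 0)) := by
    rw [← hF 0, fieldHamiltonian_zero]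
  -- the moment in terms of the trace
  have hmom : sys.moment β k = ((N : ℝ) ^ (2 * k))⁻¹ * (((partitionFn β sys.hamiltonian).re)⁻¹ *
      (gibbsWeight β sys.hamiltonian * sys.order ^ (2 * k)).trace.re) := by
    rw [moment, hH.re_gibbsState, hH.partitionFn_eq_ofReal, Complex.ofReal_re]
  rw [hmom]
  -- algebra
  have hNk : (0 : ℝ) < (N : ℝ) ^ (2 * k) := pow_pos hN0 _
  have hK0 : (0 : ℝ) < K := by exact_mod_cast hK
  generalize hZ0g : (partitionFn β sys.hamiltonian).re = Z0 at *
  generalize hZBg : (partitionFn β (sys.fieldHamiltonian B)).re = ZB at *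
  generalize hTg : (gibbsWeight β sys.hamiltonian * sys.order ^ (2 * k)).trace.re = T at *
  generalize hFBg : sys.freeEnergy β B = FB at *
  generalize hF0g : sys.freeEnergy β 0 = F0 at *
  have hZB_eq : ZB = Z0 * Real.exp (-(β * N * (FB - F0))) := by
    rw [← hZBg, hF B, hFBg, hF0, ← Real.exp_add]
    congr 1
    ring
  have hexp : Real.exp (-(β * B * (N * m))) * Real.exp (-(β * N * (FB - F0))) =
      Real.exp (-(β * N * (B * m + FB - F0))) := by
    rw [← Real.exp_add]
    congr 1
    ring
  have key' : T ≤ Z0 * ((N : ℝ) ^ (2 * k) * (m ^ (2 * k) +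
      32 * k ^ 3 * (2 * r * hb) ^ 2 * ob ^ (2 * k) * K ^ 2 / ℓ ^ 2 + 2 * ob ^ (2 * k) / K +
      2 * ob ^ (2 * k) * Real.exp (β * ℓ) * Real.exp (-(β * N * (B * m + FB - F0))))) := by
    refine key.trans (le_of_eq ?_)
    rw [hZB_eq, ← hexp, mul_pow, mul_pow]
    field_simp
    ring
  calc ((N : ℝ) ^ (2 * k))⁻¹ * (Z0⁻¹ * T)
      ≤ ((N : ℝ) ^ (2 * k))⁻¹ * (Z0⁻¹ * (Z0 * ((N : ℝ) ^ (2 * k) * (m ^ (2 * k) +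
          32 * k ^ 3 * (2 * r * hb) ^ 2 * ob ^ (2 * k) * K ^ 2 / ℓ ^ 2 + 2 * ob ^ (2 * k) / K +
          2 * ob ^ (2 * k) * Real.exp (β * ℓ) * Real.exp (-(β * N * (B * m + FB - F0))))))) := by
        gcongr
    _ = _ := by field_simp

/-- **KT93 (5.3) for one finite system, explicit constants** (the finite-volume content of
Theorem 2.1): for `β > 0`, `B ≥ 0`, any real `m`, any `k`, block width `ℓ > 0` and sub-division
number `K ≥ 1`,
`N^{-2k}⟨O_Λ^{2k}⟩_Λ(0) ≤ m^{2k} + 32k³(2rh̄)²ō^{2k}K²/ℓ² + 2ō^{2k}/K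
   + 2ō^{2k} e^{βℓ} exp(-βN[Bm + f_Λ(B) - f_Λ(0)])`.
Printed (5.3): `≤ m^{2k} + 2ō^{2k}e^{-βNδ}e^{βh̄√N} + 2rk4^kō^{2k}N^{-1/4}` (with `ℓ = h̄√N`,
`D = ℓ/(2K) = h̄N^{1/4}` and `δ = Bm + f(B) - f(0)` after (4.21)–(4.24)); the proof here runs KT's
§§3–5 in the eigenbasis of `H_Λ` (unitarily invariant quantities) with the Lemma 3.1 grid chosen by a
uniform shift and (3.29) telescoped. [cite: KomaTasaki1993, Theorem 2.1, proof §§3–5, (5.3)] -/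
theorem moment_le_finiteVolume [Nonempty n] (hN : 1 ≤ N) {β : ℝ} (hβ : 0 < β) {B : ℝ} (hB : 0 ≤ B)
    (m : ℝ) (k : ℕ) {ℓ : ℝ} (hℓ : 0 < ℓ) {K : ℕ} (hK : 1 ≤ K) :
    sys.moment β k ≤ m ^ (2 * k) + 32 * k ^ 3 * (2 * r * hb) ^ 2 * ob ^ (2 * k) * K ^ 2 / ℓ ^ 2 +
      2 * ob ^ (2 * k) / K +
      2 * ob ^ (2 * k) * Real.exp (β * ℓ) *
        Real.exp (-(β * N * (B * m + sys.freeEnergy β B - sys.freeEnergy β 0))) :=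
  sys.moment_le_finiteVolume_aux hN hβ hB m k hℓ hK sys.isHermitian_hamiltonian.eigenvectorUnitary.prop
    sys.isHermitian_hamiltonian.star_mul_self_mul_eq_diagonal

end Z2System

end Frame

/-! ### KT93 Theorem 2.1: the thermodynamic limit (discharge of the named fact) -/

section Limit

universe v

/-- **Koma–Tasaki 1993, Theorem 2.1 — PROVED** (discharge of the named fact `kt93_theorem_2_1`):
for every sequence of models with uniform constants (`Z2System`, hypotheses ii), iii), (2.3), (2.5)),
`N_j → ∞`, `β > 0` and hypothesis i) (convergence of the free energies per site), for every `k ≥ 1`,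
`B > 0`, `ε > 0`, eventually in `j, j'`:
`(N_{j'}^{-2k}⟨O^{2k}⟩_{Λ_{j'}}(0))^{1/(2k)} ≤ N_j⁻¹⟨O⟩_{Λ_j}(B) + ε` — i.e.
`limsup_Λ (N^{-2k}⟨O^{2k}⟩_Λ(0))^{1/(2k)} ≤ liminf_Λ N⁻¹⟨O_Λ⟩_Λ(B)` (2.13′).  Proof = KT93 §5: the
finite-volume inequality (5.3) (`Z2System.moment_le_finiteVolume`) with `m = c + ε/4`,
`c = lim_j (f_j(0) - f_j(B))/B` (hypothesis i) at the two fields `0` and `B` — the "`δ`" of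
(4.21)–(4.24)), constants `K`, `ℓ` chosen from `ε`, and `N_j → ∞`; on the magnetisation side the
finite-volume concavity (4.6) `m_Λ(B) ≥ (f_Λ(0) - f_Λ(B))/B` and `f_Λ(B) ≤ f_Λ(0)`.
[cite: KomaTasaki1993, Theorem 2.1 (2.13); proof §§3–5, (4.6), (4.21)–(4.24), (5.3)] -/
theorem kt93_theorem_2_1_holds : kt93_theorem_2_1.{v} := by
  intro hb ob r N n _ _ _ sys β hβ hN hlim k hk B hB ε hε
  -- hypothesis i) at the two fields `0` and `B`
  obtain ⟨fB, hfB⟩ := hlim B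
  obtain ⟨f0, hf0⟩ := hlim 0
  set c : ℝ := (f0 - fB) / B with hc_def
  have hcj : Tendsto (fun j => ((sys j).freeEnergy β 0 - (sys j).freeEnergy β B) / B) atTop (𝓝 c) :=
    (hf0.sub hfB).div_const B
  have hcj_nonneg : ∀ j, 0 ≤ ((sys j).freeEnergy β 0 - (sys j).freeEnergy β B) / B :=
    fun j => div_nonneg (sub_nonneg.mpr ((sys j).freeEnergy_le_freeEnergy_zero hβ B)) hB.le
  have hcj_le : ∀ j, ((sys j).freeEnergy β 0 - (sys j).freeEnergy β B) / B ≤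
      (sys j).magnetisation β B := by
    intro j
    rw [div_le_iff₀ hB]
    have := (sys j).freeEnergy_zero_le hβ B
    linarith
  have hc0 : 0 ≤ c := ge_of_tendsto' hcj hcj_nonneg
  -- a-priori: `ō ≥ 0` eventually (from `N_j ≥ 1`); we only need `0 ≤ ob ^ (2k)` which we get from
  -- a site bound once some `N j ≥ 1`.
  obtain ⟨j₁, hj₁⟩ := Filter.eventually_atTop.mp (hN.eventually_ge_atTop 1)
  have hob : 0 ≤ ob := (norm_nonneg _).trans ((sys j₁).norm_o_le ⟨0, hj₁ j₁ le_rfl⟩)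
  have hk0 : 2 * k ≠ 0 := by omega
  -- the gap `η`
  set m : ℝ := c + ε / 4 with hm_def
  set η : ℝ := (c + ε / 2) ^ (2 * k) - (c + ε / 4) ^ (2 * k) with hη_def
  have hη : 0 < η :=
    sub_pos.mpr (pow_lt_pow_left₀ (by linarith) (by positivity) hk0)
  -- choice of `K`
  set C₃ : ℝ := 2 * ob ^ (2 * k) with hC₃
  have hC₃0 : 0 ≤ C₃ := by positivity
  obtain ⟨K, hK⟩ := exists_nat_gt (4 * C₃ / η)
  have hK0 : (0 : ℝ) < K := lt_of_le_of_lt (by positivity) hK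
  have hK1 : 1 ≤ K := by exact_mod_cast hK0
  have hKterm : C₃ / K ≤ η / 4 := by
    rw [div_le_iff₀ hK0]
    rw [div_lt_iff₀ hη] at hK
    linarith
  -- choice of `ℓ`
  set C₂ : ℝ := 32 * k ^ 3 * (2 * r * hb) ^ 2 * ob ^ (2 * k) * K ^ 2 with hC₂
  have hC₂0 : 0 ≤ C₂ := by positivity
  set ℓ : ℝ := 4 * C₂ / η + 1 with hℓ_def
  have hℓ1 : 1 ≤ ℓ := by
    have h4 : 0 ≤ 4 * C₂ / η := by positivity
    rw [hℓ_def]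
    linarith
  have hℓ0 : 0 < ℓ := lt_of_lt_of_le one_pos hℓ1
  have hℓterm : C₂ / ℓ ^ 2 ≤ η / 4 := by
    calc C₂ / ℓ ^ 2 ≤ C₂ / ℓ := by
          apply div_le_div_of_nonneg_left hC₂0 hℓ0
          nlinarith
      _ ≤ η / 4 := by
          rw [div_le_iff₀ hℓ0, hℓ_def]
          have : η / 4 * (4 * C₂ / η + 1) = C₂ + η / 4 := by field_simp
          rw [this]
          linarith
  -- the exponential term tends to zero
  set C₄ : ℝ := C₃ * Real.exp (β * ℓ) with hC₄
  set δ : ℝ := β * (B * (ε / 8)) with hδ_def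
  have hδ : 0 < δ := by positivity
  have hg : Tendsto (fun j => C₄ * Real.exp (-(δ * N j))) atTop (𝓝 0) := by
    have h1 : Tendsto (fun j => δ * (N j : ℝ)) atTop atTop :=
      (tendsto_natCast_atTop_atTop.comp hN).const_mul_atTop hδ
    have h2 : Tendsto (fun j => Real.exp (-(δ * N j))) atTop (𝓝 0) :=
      Real.tendsto_exp_atBot.comp (tendsto_neg_atTop_atBot.comp h1)
    simpa using h2.const_mul C₄
  -- collect the eventual conditions
  have hE1 : ∀ᶠ j in atTop, 1 ≤ N j := hN.eventually_ge_atTop 1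
  have hE2 : ∀ᶠ j in atTop,
      dist (((sys j).freeEnergy β 0 - (sys j).freeEnergy β B) / B) c < ε / 8 :=
    Metric.tendsto_nhds.mp hcj (ε / 8) (by positivity)
  have hE3 : ∀ᶠ j in atTop, dist (C₄ * Real.exp (-(δ * N j))) 0 < η / 4 :=
    Metric.tendsto_nhds.mp hg (η / 4) (by positivity)
  obtain ⟨j₀, hj₀⟩ := Filter.eventually_atTop.mp (hE1.and (hE2.and hE3))
  refine ⟨j₀, fun j j' hj hj' => ?_⟩
  obtain ⟨-, hj2, -⟩ := hj₀ j hj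
  obtain ⟨hj'1, hj'2, hj'3⟩ := hj₀ j' hj'
  rw [Real.dist_eq, abs_lt] at hj2 hj'2
  rw [Real.dist_eq, sub_zero, abs_lt] at hj'3
  -- magnetisation side (volume `j`): `m_j(B) ≥ c_j > c - ε/8`
  have hmag : c - ε / 8 ≤ (sys j).magnetisation β B := by linarith [hcj_le j, hj2.1]
  -- moment side (volume `j'`): the finite-volume inequality (5.3)
  have hfin := (sys j').moment_le_finiteVolume hj'1 hβ hB.le m k hℓ0 hK1
  -- the exponent: `B m + f(B) - f(0) = B (m - c_{j'}) ≥ B ε / 8`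
  have hexp : 2 * ob ^ (2 * k) * Real.exp (β * ℓ) *
      Real.exp (-(β * N j' * (B * m + (sys j').freeEnergy β B - (sys j').freeEnergy β 0))) ≤
      C₄ * Real.exp (-(δ * N j')) := by
    rw [hC₄, hC₃]
    refine mul_le_mul_of_nonneg_left (Real.exp_le_exp.mpr ?_) (by positivity)
    rw [hδ_def, neg_le_neg_iff]
    have hcj' : ((sys j').freeEnergy β 0 - (sys j').freeEnergy β B) / B < c + ε / 8 := by
      linarith [hj'2.2]
    have hkey : B * (ε / 8) ≤ B * m + (sys j').freeEnergy β B - (sys j').freeEnergy β 0 := by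
      have h1 : (sys j').freeEnergy β 0 - (sys j').freeEnergy β B < B * (c + ε / 8) := by
        rwa [div_lt_iff₀ hB, mul_comm] at hcj'
      rw [hm_def]
      nlinarith
    have hN0 : (0 : ℝ) ≤ N j' := Nat.cast_nonneg _
    calc β * (B * (ε / 8)) * N j' = β * N j' * (B * (ε / 8)) := by ring
      _ ≤ β * N j' * (B * m + (sys j').freeEnergy β B - (sys j').freeEnergy β 0) :=
          mul_le_mul_of_nonneg_left hkey (mul_nonneg hβ.le hN0)
  have hmo : (sys j').moment β k ≤ (c + ε / 2) ^ (2 * k) := by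
    have hsum : m ^ (2 * k) + η / 4 + η / 4 + η / 4 ≤ (c + ε / 2) ^ (2 * k) := by
      rw [hη_def, hm_def]; linarith
    refine le_trans hfin (le_trans ?_ hsum)
    have h2 : 32 * (k : ℝ) ^ 3 * (2 * r * hb) ^ 2 * ob ^ (2 * k) * K ^ 2 / ℓ ^ 2 ≤ η / 4 := hℓterm
    have h3 : 2 * ob ^ (2 * k) / K ≤ η / 4 := hKterm
    linarith [hj'3.2]
  -- `2k`-th root
  have hroot : ((sys j').moment β k) ^ ((1 : ℝ) / (2 * k)) ≤ c + ε / 2 := by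
    have hpow : (1 : ℝ) / (2 * k) = (((2 * k : ℕ) : ℝ))⁻¹ := by push_cast; rw [one_div]
    have h := Real.rpow_le_rpow ((sys j').moment_nonneg β k) hmo
      (by positivity : (0 : ℝ) ≤ 1 / (2 * k))
    rw [hpow] at h ⊢
    rwa [Real.pow_rpow_inv_natCast (by linarith) hk0] at h
  linarith

/-- **No spontaneous magnetisation ⟹ no long-range order — PROVED** (unconditional form of
`sqrt_moment_eventually_le_of_magnetisation_eventually_le`, fed with `kt93_theorem_2_1_holds`): in
the setting of Theorem 2.1, if for every `ε > 0` there is a field `B > 0` at which the order parameter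
per site is eventually `≤ ε` along the sequence (e.g. a Mermin–Wagner bound uniform in the volume),
then `σ = 0`: `√(N_j⁻²⟨(O_{Λ_j})²⟩_{Λ_j}(0)) ≤ ε` eventually.  This is the use of Theorem 2.1 recorded in
`HeisenbergOrder.mermin_wagner{,_staggered,_general}` ("`σ ≤ m_s = 0`"), now a theorem.
[cite: KomaTasaki1993, Theorem 2.1 (2.13), contrapositive use, §1 pp. 192–193] -/
theorem sqrt_moment_eventually_le_of_magnetisation_eventually_le_holds
    {hb ob : ℝ} {r : ℕ} {N : ℕ → ℕ} {n : ℕ → Type v} [∀ j, Fintype (n j)]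
    [∀ j, DecidableEq (n j)] [∀ j, Nonempty (n j)] (sys : (j : ℕ) → Z2System (N j) hb ob r (n j))
    {β : ℝ} (hβ : 0 < β) (hN : Tendsto N atTop atTop)
    (hlim : ∀ B : ℝ, ∃ f : ℝ, Tendsto (fun j => (sys j).freeEnergy β B) atTop (𝓝 f))
    (hsmall : ∀ ε : ℝ, 0 < ε → ∃ B : ℝ, 0 < B ∧ ∃ j₀ : ℕ, ∀ j : ℕ, j₀ ≤ j →
      (sys j).magnetisation β B ≤ ε) :
    ∀ ε : ℝ, 0 < ε → ∃ j₀ : ℕ, ∀ j : ℕ, j₀ ≤ j → Real.sqrt ((sys j).moment β 1) ≤ ε :=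
  sqrt_moment_eventually_le_of_magnetisation_eventually_le kt93_theorem_2_1_holds sys hβ hN hlim hsmall

end Limit

end Literature.MathematicalPhysics.QuantumLattice.KomaTasaki

end
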